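import Summits.BirchSwinnertonDyer.BirchSwinnertonDyer.Theses.GenusKolyvaginAtTwo
import Summits.BirchSwinnertonDyer.BirchSwinnertonDyer.Theorems.GenusKolyvaginAtTwoK4NegOffCutNonPhantomAtTwoMult
import Summits.BirchSwinnertonDyer.BirchSwinnertonDyer.Theorems.GenusKolyvaginAtTwoGenusDeepSupplyAtTwoNegDiscNarrowKFourCellLeafCurrency
import Summits.BirchSwinnertonDyer.BirchSwinnertonDyer.Theses.ByReductionTypeAtTwo
import Summits.BirchSwinnertonDyer.BirchSwinnertonDyer.Theorems.GenusKolyvaginAtTwoGenusPrimitiveSupplyAtTwoPosDiscShallowKFourPosBTwoSharpIff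
import Summits.BirchSwinnertonDyer.BirchSwinnertonDyer.Theorems.GenusKolyvaginAtTwoGenusDeepSupplyAtTwoNegDiscNarrowKFourCellShaCardCurrency
import Summits.BirchSwinnertonDyer.BirchSwinnertonDyer.Theorems.GenusKolyvaginAtTwoGenusPrimitiveSupplyAtTwoPosDiscShallowKFourPosHalvingDescentCorollaries
import Summits.BirchSwinnertonDyer.BirchSwinnertonDyer.Theorems.GenusKolyvaginAtTwoMinimalTwinBSDTwoSwappedPairFrame
import Summits.BirchSwinnertonDyer.BirchSwinnertonDyer.Theorems.GenusKolyvaginAtTwoK4NegPhantomCellHalvingBit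
import Literature.NumberTheory.EllipticCurves.HeegnerPointsKolyvaginExceptionalTwistProofs
import Literature.NumberTheory.EllipticCurves.BSDRootNumberSmallConductorProofs
import HarnessLib

/-!
# LINE 34 «twin_bsd_road⁻» — crux K₄⁻ `K4Neg` (stmt-BirchSwinnertonDyer-31526), route `GenusKolyvaginAtTwo` (Δ < 0 mirror of LINE 33 on K₄⁺)

Ideator seat `bsd-idea-1` (D-0145), generations 27–28; technique card «compactness–contradiction / rigidity».  A LINES workfile:
`theorem stub_* … := by sorry` are the REGISTERED-SHAPE STUBS (four: F1⁻, F2L⁻, F4⁻ — the v1.0/v1.1 roads — and the v1.6 residual F4ᶠ (the UNHALVABLE = phantom-twin frames) on the WALL road); `K4Neg_of` is the kernel-checked composition concluding the crux BY NAME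
(`Summit.BirchSwinnertonDyer.BirchSwinnertonDyer.Theses.GenusKolyvaginAtTwo.K4Neg`) modulo TWO OPEN ROUTE ITEMS, both binders of `closes`: Q2 =
`KolyvaginRelationAtTwo` (stmt-24880) and U₂ = `MinimalTwinBSDTwo` (stmt-22985), plus the four PRINT items.  **No summit is proved by a line; BSD is
not proved here; K4Neg is NOT proved here (four `sorry`s; the WALL road has three OPEN route items + PRINT as hypotheses and the residual F4ᶠ).**

**v1.6 (§6, g28; LEAD-BRIEF-g28 §4 executed HONESTLY) — THE HALVING BIT.**  The LEAD's landed ★★ `PlusDescent.kFourNeg_conclusion_of_bsdp_pair_of_halvingBit`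
(`…K4NegPhantomCellHalvingBit`, 0 sorry) gives K₄⁻'s conclusion on ANY `Δ < 0` frame (no cut, any reduction at `2`) from `BSD₂(E)` (WALL row 1) + `BSD₂(Wd)` (U₂) +
Q2 + PRINT + the halving bit hHalf «a `K`-point halvable over `K(E[4])` is halvable over `K`».  The composition now splits FIRST on hHalf (★★ by name), and
only on `¬ hHalf` falls back to the v1.5 roads (cut: §4, no stub; `2`-multiplicative: §5 + gk2-p5 g41, no stub); the ONE residual stub is F4ᶠ
`stub_offCut_notMultAtTwo_unhalvable` = F4ᵖᵍ ∧ `¬ hHalf`.  hHalf is NOT filed as a blanket stub because it is FALSE on the phantom-twin frames `𝒫`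
(LEAD-BRIEF-g28 §3: `¬ hHalf ⟺ ξ_E ∈ Sel₂(Wd) ⟺ loc_(ℓ₀) ξ_E = 0`; gk2-p4 g34 `…K4NegPhantomFrameEntangledIffTrace`: `⟺ ξ_E ∈ Sel₂(E) ∧ 4 ∣ a_(ℓ₀)(E)`;
instrument PN-split j341556: 47628e1@47 is such a frame, `a_47 = −12`).  CENSUS v1.6: modulo {WALL row 1, U₂, Q2, PRINT} the ENTIRE content of `K4Neg` is F4ᶠ —
K₄⁻ on the frames (`E`, `ℚ(√−ℓ₀)`) with `ξ_E ∈ Ш(E)[2]` and `4 ∣ a_(ℓ₀)(E)`, where no engine exists and the LEAD suspects K₄⁻ is FALSE (disprover-wanted);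
and the `∃ K` parent crux 23491 NO LONGER NEEDS IT (LINE 38 «steered_supply» on 23491: steer `ℓ₀` to `a_(ℓ₀) ≡ 2 (mod 4)`).**

**v1.3 (§5) — THE 2-ADIC FORM.**  The only stub on the shortest path is now F4″ `stub_offCutNonPhantomAtTwo`: (NPh_K) with the Kummer condition imposed ONLY at the two
places of `K` over `2` (`2` split in `K`, the frame's `h2K`); F4′ = `offCutNonPhantom_of_atTwo` is a theorem from it, and conversely nothing is lost by the tree's silence theorems
(gk2-p5 g20 `…RTNonPhantomAdditive.lean`).  CENSUS: modulo the route's own items the entire content of `K4Neg` is a statement about `E/ℚ₂` and `D₂ ≤ GL₂(ℤ/2^L)`.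

**v1.2 (§5) — OFF THE CUT.**  F4 ⟸ WALL row 1 + U₂ + Q2 + PRINT + F4′ with F4′ = (NPh_K) «no everywhere-locally-Kummer PHANTOM class in
`H¹(K(E[2^L])/K, E[2^L])`, `L ≥ 1`» on the off-cut K₄⁻ cell (new stub `stub_offCutNonPhantom`, curve-and-field level; the LEAD's hypothesis of the
master halving descent, discharged in the tree ONLY at a Tate prime); `offCut_of_wall_U2_of_nonPhantom` is SORRY-FREE given (NPh_K), and
`K4Neg_of_wall_U2_nonPhantom : WALL rows → U₂ → Q2 → PRINT → K4Neg` has F4′ as its ONLY stub.  CENSUS: modulo the route's own items the entire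
content of `K4Neg` is (NPh_K) off the cut — finite Galois cohomology of `GL₂(ℤ/2^L)` plus LOCAL conditions at the primes over `2` and at the additive primes.

**v1.1 (§4) — THE STUB-FREE ROAD ON THE CUT.**  The LEAD's leaf currency (`kFourNeg_conclusion_iff_bsdp`: on a K₄⁻ frame with an odd multiplicative
prime, given `BSDp Wd 2` + Q2 + PRINT, the K₄⁻ conclusion ↔ `BSDp W 2`) fed by WALL row 1 (`ByReductionTypeAtTwo` rows 19095–19098 BY NAME) and U₂ BY NAME
gives `onCut_of_wall_U2` with NO `sorry`, and `K4Neg_of_wall_U2 : … → K4Neg` whose ONLY stub is F4 (off cut).  So F1, F2L (and LINE 32's F2T) are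
DOMINATED by WALL row 1 + U₂ given Q2 + PRINT — kernel-certified; the critic's booking «F1 = WALL» (#504/#511 P1) is a theorem of the tree's items; the
only content of K₄⁻ outside {WALL row 1, U₂, Q2, PRINT} is the OFF-CUT residual F4.  §§1–3 are kept as the record of the frame-rigidity road.

## The finding (mirror of LINE 33; new relative to LINE 32 «frame_rigidity⁻», same seat g26)

LINE 32 derived F2⁻ (depth rigidity `M₀ = M₁` across admissible prime frames of a K₄⁻ cell curve) from F2T⁻ (unit-layer transport, RESEARCH) +
F2Z⁻ (unit-twin supply, OPEN ∃) + F2L⁻ (two-frame ledger, PRINT) + a PARITY step on the Tamagawa budgets `ord₂ C(Wd_i) ≤ 1`.  THIS LINE: each frame's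
`Sel₂`-minimal rank-one twin `Wd_i ≅ E^(−ℓ_i)` is non-CM (`not_hasCM_twin`), of analytic rank `1`, `#Sel₂ = 2` — an INSTANCE of the route item U₂; and
`BSDp Wd_i 2` UNPACKS (PROVED, `unitSha_of_bsdp`) to `ord₂ Ш_an(Wd_i) = 0`.  With F2L⁻ and the parity step this gives F2⁻ with no `sorry` of its own
(`depthRigidity_of_minimalTwinBSDTwo`).  So modulo the `closes` binders Q2, U₂, PRINT the beyond-print content of K₄⁻ is EXACTLY «F1⁻ on the cut at
depth ≥ 2» + «F4⁻ off the cut»; F2T⁻ / F2Z⁻ leave the route's critical path (they remain the U₂-free road).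

Stubs (3): F1⁻ `stub_frameAttainment`, F2L⁻ `stub_twoFrameLedger` (PRINT), F4⁻ `stub_offCut` (RESIDUAL) — byte-identical with LINE 32.
Composition `K4Neg_of (hQ2 hTw hGZ hGZK hL hMi)`.

References: [Kolyvagin1989Izv] Thm. B₂ · [GrossZagier1986] V §2 (2.2) · [GrossLMS1991] §2, §5 Prop. 5.3 · [McCallumLMS1991] §5 · [Miller2011LMS] Def. 1.1 ·
[SilvermanAEC2009] III.1.4(b), X.4.2.


**v1.5 (2026-08-30 19:45Z) — THE SPLIT AT `2` (§6).**  The tree moved while v1.4 was written: gk2-p4 g32 proved that OFF THE CUT (NPh_K) ⟺ the 2-adic bit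
«`ξ_E` not Kummer at `ℚ₂`» (`…K4NegTwinBsdRoadNonPhantomTwoAdicIff`), and gk2-p5 g41 proved the bit at a `2`-multiplicative place
(`…K4NegOffCutNonPhantomAtTwoMult`, F4″⁻ binders verbatim + `v₂ ∋ 2` multiplicative).  Re-reading this seat's LW2 table (g24, kit j339762) in that language:
the bit is FALSE on 32/32 `Δ < 0` off-cut cells `N < 5·10⁵` not multiplicative at `2` (16 good-supersingular, 16 additive II*/IV/IV*) and TRUE on the 2
multiplicative ones — so on K₄⁻ the NPh road is EXACTLY the `2`-multiplicative slice.  v1.5: that slice is plugged by name (no stub); F4ˢˢ and F4″ⁿˢˢ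
(v1.4) are dropped (F4″ⁿˢˢ is false on the additive cells); ONE residual F4ᵖᵍ `stub_offCut_notMultAtTwo` (off-cut, not multiplicative at `2`) carries the
whole remaining content of the kernel K₄ = K₄⁺ ∪ K₄⁻ modulo the route's own items (K₄⁺ closed mod items by gk2-p4's real-witness theorem, LINE 33 v1.5).
Stubs: F1⁻, F2L⁻, F4⁻, F4ᵖᵍ (4); shortest path `K4Neg_of_wall_U2_split`: F4ᵖᵍ only.  Nothing is closed; no summit is proved by a line.

**v1.4 (2026-08-30 19:14Z).**  LEVEL-2 VERDICT ON THE NPh ROAD (card §7): on the good-SUPERSINGULAR off-cut habitat the unique level-`2` phantom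
`φ₂` is a NON-ZERO element of `Sel₄(E/K)` (`2` split in `K`): for `a₂ = 0` it is locally `0` at `2` (`D₂ ≤ N(C_ns(4))`, Sah), for `a₂ = ±2` its restriction
at `2` is the Kummer class `δ(2P)` (square-class computation, kit j341300, 10/10 curves incl. 9747h1/i1, uniform as Honda's theorem predicts); odd additive
places are silent (`c_p` odd) and good places unramified.  Hence (NPh_K) — v1.3's F4″/F4′, LINE 18's NPh stub, LINE 26's habitat stub and the LEAD's (NPh_M)
— is FALSE at `L = 2` on that habitat (instance 9747h1, `K = ℚ(√−71)`); v1.4 WITHDRAWS F4″/F4′ there, files the residual F4ˢˢ (no mechanism; the typed phantom-Selmer lemma T_C explains why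
Kolyvagin-type arguments cannot see the obstruction) and keeps the NPh road on the non-supersingular habitat only (F4″ⁿˢˢ).  Stubs: F1, F2L, F4, F4ˢˢ, F4″ⁿˢˢ (5);
shortest path `K4Neg_of_wall_U2_split`: F4ˢˢ + F4″ⁿˢˢ.  Nothing is closed; no summit is proved by a line.
-/

set_option autoImplicit false
set_option linter.dupNamespace false
set_option linter.unusedVariables false

noncomputable section

open scoped Classical

namespace Summit.BirchSwinnertonDyer.BirchSwinnertonDyer.Cruxes.K4Neg.TwinBsdRoad

open WeierstrassCurve NumberField IsDedekindDomain Field Literature.NumberTheory.EllipticCurves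
  Literature.NumberTheory.GaloisRepresentations Literature.NumberTheory.EllipticCurves.ModularForms
  Literature.NumberTheory.EllipticCurves.RingClassField
open Summit.BirchSwinnertonDyer.BirchSwinnertonDyer.Theses.GenusKolyvaginAtTwo
open Summit.BirchSwinnertonDyer.BirchSwinnertonDyer.Theorems.GenusSupplyNarrow.KFourCell.ShaCardCurrency
  (kFourNeg_conclusion_iff_natCard_sha_rat_eq_pow)

/-! ## §0 The unpacking lemma (PROVED): `BSD₂` of a `Sel₂`-minimal rank-one curve is the unit layer `ord₂ Ш_an = 0` -/

/-- **`BSD₂(Wd) ⟹ ord₂ Ш_an(Wd) = 0`** for an elliptic, globally minimal `Wd/ℚ` of analytic rank `1` with `#Sel₂(Wd) = 2` (Miller (iv) + `#Sel₂ = 2 ∧ rank ≥ 1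
⟹ Ш(Wd)[2^∞] = 0`, the LEAD's `TwinSwap.rank_eq_one_and_sha_primary_eq_zero_of_natCard_selmerGroup_eq_two`). [cite: Miller2011LMS, Def. 1.1] [cite: SilvermanAEC2009, X.4.2] -/
theorem unitSha_of_bsdp (Wd : WeierstrassCurve ℚ) [Wd.IsElliptic] [Wd.IsGloballyMinimal] (hB : BSDp Wd 2) (hrd : Wd.analyticRank = 1)
    (hSel : Nat.card (Wd.selmerGroup 2) = 2) : ∃ q : ℚ, shaAn Wd = (q : ℂ) ∧ padicValRat 2 q = 0 := by
  obtain ⟨hrk, _hfin, q, hq, hv⟩ := hB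
  have h1 : 1 ≤ Wd.mordellWeilRank := by rw [hrk, hrd]
  obtain ⟨-, -, hsha⟩ :=
    Summit.BirchSwinnertonDyer.BirchSwinnertonDyer.Theorems.GenusExact.TwinSwap.rank_eq_one_and_sha_primary_eq_zero_of_natCard_selmerGroup_eq_two
      Wd hSel h1
  have hsub : Subsingleton (AddCommGroup.primaryComponent (↥Wd.sha) 2) :=
    ⟨fun a b ↦ Subtype.ext ((hsha a.1 a.2).trans (hsha b.1 b.2).symm)⟩
  have hcard : Nat.card (AddCommGroup.primaryComponent (↥Wd.sha) 2) = 1 :=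
    Nat.card_eq_one_iff_unique.mpr ⟨hsub, ⟨0⟩⟩
  refine ⟨q, hq, ?_⟩
  rw [hv, hcard]
  simp

/-- The `Sel₂`-minimal twin of an admissible frame of a non-CM `E` is non-CM (same `j`-invariant). [cite: SilvermanAEC2009, III.1.4(b)] -/
theorem not_hasCM_twin (W : WeierstrassCurve ℚ) [W.IsElliptic] (hcm : ¬ W.HasCM) (K : Type) [Field K] [NumberField K]
    (Wd : WeierstrassCurve ℚ) (hWd : ∃ C : VariableChange ℚ, C • W.quadraticTwist (NumberField.discr K : ℚ) = Wd) : ¬ Wd.HasCM := by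
  obtain ⟨C, hC⟩ := hWd
  have hd : (NumberField.discr K : ℚ) ≠ 0 := Int.cast_ne_zero.mpr (NumberField.discr_ne_zero K)
  haveI := W.isElliptic_quadraticTwist hd
  rw [← hC]
  exact not_hasCM_variableChange _ C (not_hasCM_quadraticTwist W hd hcm)

/-! ## §1 The three stubs (F1⁻ · F2L⁻ PRINT · F4⁻ RESIDUAL), byte-identical with LINE 32 «frame_rigidity⁻» -/

/-- **F1⁻ — FRAME ATTAINMENT (stub, rank 2 of the line).**  For `E = W` on the K₄⁻ cell WITH an odd multiplicative prime and an odd-Manin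
parametrisation `Dt`, given ONE admissible prime frame `K₀` (all K₄⁻ frame binders), there is an admissible prime frame `K₁` of the same `E`
(same binders, its own datum, exact depth `M₁ ≥ 1`, its own `Sel₂`-minimal rank-one twin with `ord₂ C ≤ 1`) at which the depth ATTAINS the
`Ш`-exponent: `#Ш(E/ℚ)[2^∞] = 2^(2·M₁)`.  Equivalently SOME frame carries a K₄⁻ witness; equivalently `min_K M₀(E,K) = e(E)`.  Asked only at
DEPTH `M₀ ≥ 2` of the given frame: depth ONE on the cut is the LEAD's THEOREM `PlusDescent.kFourNeg_conclusion_of_depth_one_of_hasMultiplicativeReductionAt`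
(item 33814 `K4NegDepthOneOnCut`, CLOSED proved p777220), consumed by name in the composition.
Why it might fail: only with BSD₂ (for `E` or for every rank-one prime twin in the cell).  HONEST LABEL (critic #511 P1, booked): through the GZ ledger
and U₂ it is the rank-`0` `2`-part inequality in the L-value (Skinner–Urban) direction for the `#Sel₂ = 4` cell curve `E` — the WALL.
[cite: Kolyvagin1989Izv, Thm. B₂] [cite: GrossLMS1991, §2 Conj. 2.2] -/
theorem stub_frameAttainment
    (W : WeierstrassCurve ℚ) [W.IsElliptic] [W.IsGloballyMinimal] [NeZero (W.conductorNorm ℤ)]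
    (hcm : ¬ W.HasCM) (hr0 : W.analyticRank = 0) (hρ : ∀ n : ℕ, 0 < n → W.HasSurjectiveModNGaloisRep ((2 : ℤ) ^ n))
    (hT : Odd W.tamagawaProduct) (hneg : W.Δ < 0) (h4 : Nat.card (W.selmerGroup 2) = 4)
    (v : HeightOneSpectrum (𝓞 ℚ)) (h2v : ((2 : ℕ) : 𝓞 ℚ) ∉ v.asIdeal)
    (hNv : ((W.conductorNorm ℤ : ℕ) : 𝓞 ℚ) ∈ v.asIdeal) (hmult : W.HasMultiplicativeReductionAt v)
    (K₀ : Type) [Field K₀] [NumberField K₀] (hIQ₀ : IsImaginaryQuadratic K₀) (hodd₀ : Odd (NumberField.discr K₀))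
    (h3₀ : NumberField.discr K₀ ≠ -3) (hHe₀ : SatisfiesHeegnerHypothesis (W.conductorNorm ℤ) K₀)
    (hsq1₀ : ¬ IsSquare ((NumberField.discr K₀ : ℚ) * -|W.Δ|)) (hsq2₀ : ¬ IsSquare ((NumberField.discr K₀ : ℚ) * (-(2 * |W.Δ|))))
    (ℓ₀ : ℕ) (hℓ₀ : ℓ₀.Prime) (hdK₀ : NumberField.discr K₀ = -(ℓ₀ : ℤ))
    (h2K₀ : ((Ideal.span {(2 : ℤ)}).primesOver (𝓞 K₀)).ncard = 2)
    (Dt : ModularParametrizationData W (W.conductorNorm ℤ))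
    (hopt : ∀ z ∈ Dt.L.lattice, ∃ w ∈ periodLattice Dt.f, z = (Dt.c : ℂ) * w) (hc : Odd Dt.c)
    (β₀ : ℤ) (ι₀ : K₀ →+* ℂ) (d₀ : KolyvaginHeegnerData Dt β₀ ι₀ 1) (hy₀ : ¬ IsOfFinAddOrder d₀.derivedPoint)
    (M₀ : ℕ) (hdiv₀ : ∃ Q : (W.baseChange (ringClassField K₀ ι₀ 1)).toAffine.Point, ((2 ^ M₀ : ℕ) : ℤ) • Q = d₀.derivedPoint)
    (hndiv₀ : ¬ ∃ Q : (W.baseChange (ringClassField K₀ ι₀ 1)).toAffine.Point, ((2 ^ (M₀ + 1) : ℕ) : ℤ) • Q = d₀.derivedPoint)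
    (hM₀ : 1 ≤ M₀) (hM₀2 : 2 ≤ M₀)
    (Wd₀ : WeierstrassCurve ℚ) [Wd₀.IsElliptic] [Wd₀.IsGloballyMinimal]
    (hWd₀ : ∃ C : VariableChange ℚ, C • W.quadraticTwist (NumberField.discr K₀ : ℚ) = Wd₀)
    (hrd₀ : Wd₀.analyticRank = 1) (hSel₀ : Nat.card (Wd₀.selmerGroup 2) = 2) (hDEF₀ : padicValNat 2 Wd₀.tamagawaProduct ≤ 1) :
    ∃ (K₁ : Type) (_ : Field K₁) (_ : NumberField K₁),
      IsImaginaryQuadratic K₁ ∧ Odd (NumberField.discr K₁) ∧ NumberField.discr K₁ ≠ -3 ∧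
      SatisfiesHeegnerHypothesis (W.conductorNorm ℤ) K₁ ∧
      ¬ IsSquare ((NumberField.discr K₁ : ℚ) * -|W.Δ|) ∧ ¬ IsSquare ((NumberField.discr K₁ : ℚ) * (-(2 * |W.Δ|))) ∧
      ∃ (ℓ₁ : ℕ), ℓ₁.Prime ∧ NumberField.discr K₁ = -(ℓ₁ : ℤ) ∧ ((Ideal.span {(2 : ℤ)}).primesOver (𝓞 K₁)).ncard = 2 ∧
      ∃ (β₁ : ℤ) (ι₁ : K₁ →+* ℂ) (d₁ : KolyvaginHeegnerData Dt β₁ ι₁ 1), ¬ IsOfFinAddOrder d₁.derivedPoint ∧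
      ∃ (M₁ : ℕ), (∃ Q : (W.baseChange (ringClassField K₁ ι₁ 1)).toAffine.Point, ((2 ^ M₁ : ℕ) : ℤ) • Q = d₁.derivedPoint) ∧
        (¬ ∃ Q : (W.baseChange (ringClassField K₁ ι₁ 1)).toAffine.Point, ((2 ^ (M₁ + 1) : ℕ) : ℤ) • Q = d₁.derivedPoint) ∧ 1 ≤ M₁ ∧
        (∃ (Wd₁ : WeierstrassCurve ℚ) (_ : Wd₁.IsElliptic) (_ : Wd₁.IsGloballyMinimal),
          (∃ C : VariableChange ℚ, C • W.quadraticTwist (NumberField.discr K₁ : ℚ) = Wd₁) ∧ Wd₁.analyticRank = 1 ∧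
          Nat.card (Wd₁.selmerGroup 2) = 2 ∧ padicValNat 2 Wd₁.tamagawaProduct ≤ 1) ∧
        Nat.card (AddCommGroup.primaryComponent (↥W.sha) 2) = 2 ^ (2 * M₁) := by
  sorry

/-- **F2L⁻ — THE TWO-FRAME GROSS–ZAGIER LEDGER on `Δ < 0` (stub, rank 5; print-shaped, modulo the route's four print items).**  For two admissible prime frames
WITH Heegner data of a K₄⁻ cell curve and an odd-Manin `Dt`: **`2·M₀ − 2·M₁ = (ord₂ Ш_an(Wd₀) + ord₂ C(Wd₀)) − (ord₂ Ш_an(Wd₁) + ord₂ C(Wd₁))`**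
(Gross–Zagier V (2.2) at both frames; every `E`-term — `L(E,1)`, `Ш_an(E)`, `C(E)`, Manin constant, the `Δ < 0` period factor — cancels).  Why it
might fail: a frame-dependent `2`-power in the period ratio or in `c_(ℓ_i)(E^(−ℓ_i))` beyond `C(Wd_i)`; template = the LEAD's K₄⁻ currency
`kFourNeg_conclusion_iff_natCard_sha_rat_eq_pow`.  [cite: GrossZagier1986, V §2 (2.2)] [cite: GrossLMS1991, §2 (2.4)] [cite: Milne1972ArithmeticAV, §1 Thm. 1] -/
theorem stub_twoFrameLedger (hGZ : GrossZagierAllLevels) (hGZK : MultPublishedInputsAtTwo) (hL : EntireLFunctionRat) (hMi : MilneAnyModel)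
    (W : WeierstrassCurve ℚ) [W.IsElliptic] [W.IsGloballyMinimal] [NeZero (W.conductorNorm ℤ)]
    (hcm : ¬ W.HasCM) (hr0 : W.analyticRank = 0) (hρ : ∀ n : ℕ, 0 < n → W.HasSurjectiveModNGaloisRep ((2 : ℤ) ^ n))
    (hT : Odd W.tamagawaProduct) (hneg : W.Δ < 0) (h4 : Nat.card (W.selmerGroup 2) = 4)
    (Dt : ModularParametrizationData W (W.conductorNorm ℤ))
    (hopt : ∀ z ∈ Dt.L.lattice, ∃ w ∈ periodLattice Dt.f, z = (Dt.c : ℂ) * w) (hc : Odd Dt.c)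
    (K₀ : Type) [Field K₀] [NumberField K₀] (hIQ₀ : IsImaginaryQuadratic K₀) (hodd₀ : Odd (NumberField.discr K₀))
    (h3₀ : NumberField.discr K₀ ≠ -3) (hHe₀ : SatisfiesHeegnerHypothesis (W.conductorNorm ℤ) K₀)
    (hsq1₀ : ¬ IsSquare ((NumberField.discr K₀ : ℚ) * -|W.Δ|)) (hsq2₀ : ¬ IsSquare ((NumberField.discr K₀ : ℚ) * (-(2 * |W.Δ|))))
    (ℓ₀ : ℕ) (hℓ₀ : ℓ₀.Prime) (hdK₀ : NumberField.discr K₀ = -(ℓ₀ : ℤ))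
    (h2K₀ : ((Ideal.span {(2 : ℤ)}).primesOver (𝓞 K₀)).ncard = 2)
    (β₀ : ℤ) (ι₀ : K₀ →+* ℂ) (d₀ : KolyvaginHeegnerData Dt β₀ ι₀ 1) (hy₀ : ¬ IsOfFinAddOrder d₀.derivedPoint)
    (M₀ : ℕ) (hdiv₀ : ∃ Q : (W.baseChange (ringClassField K₀ ι₀ 1)).toAffine.Point, ((2 ^ M₀ : ℕ) : ℤ) • Q = d₀.derivedPoint)
    (hndiv₀ : ¬ ∃ Q : (W.baseChange (ringClassField K₀ ι₀ 1)).toAffine.Point, ((2 ^ (M₀ + 1) : ℕ) : ℤ) • Q = d₀.derivedPoint)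
    (hM₀ : 1 ≤ M₀)
    (Wd₀ : WeierstrassCurve ℚ) [Wd₀.IsElliptic] [Wd₀.IsGloballyMinimal]
    (hWd₀ : ∃ C : VariableChange ℚ, C • W.quadraticTwist (NumberField.discr K₀ : ℚ) = Wd₀)
    (hrd₀ : Wd₀.analyticRank = 1) (hSel₀ : Nat.card (Wd₀.selmerGroup 2) = 2) (hDEF₀ : padicValNat 2 Wd₀.tamagawaProduct ≤ 1)
    (K₁ : Type) [Field K₁] [NumberField K₁] (hIQ₁ : IsImaginaryQuadratic K₁) (hodd₁ : Odd (NumberField.discr K₁))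
    (h3₁ : NumberField.discr K₁ ≠ -3) (hHe₁ : SatisfiesHeegnerHypothesis (W.conductorNorm ℤ) K₁)
    (hsq1₁ : ¬ IsSquare ((NumberField.discr K₁ : ℚ) * -|W.Δ|)) (hsq2₁ : ¬ IsSquare ((NumberField.discr K₁ : ℚ) * (-(2 * |W.Δ|))))
    (ℓ₁ : ℕ) (hℓ₁ : ℓ₁.Prime) (hdK₁ : NumberField.discr K₁ = -(ℓ₁ : ℤ))
    (h2K₁ : ((Ideal.span {(2 : ℤ)}).primesOver (𝓞 K₁)).ncard = 2)
    (β₁ : ℤ) (ι₁ : K₁ →+* ℂ) (d₁ : KolyvaginHeegnerData Dt β₁ ι₁ 1) (hy₁ : ¬ IsOfFinAddOrder d₁.derivedPoint)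
    (M₁ : ℕ) (hdiv₁ : ∃ Q : (W.baseChange (ringClassField K₁ ι₁ 1)).toAffine.Point, ((2 ^ M₁ : ℕ) : ℤ) • Q = d₁.derivedPoint)
    (hndiv₁ : ¬ ∃ Q : (W.baseChange (ringClassField K₁ ι₁ 1)).toAffine.Point, ((2 ^ (M₁ + 1) : ℕ) : ℤ) • Q = d₁.derivedPoint)
    (hM₁ : 1 ≤ M₁)
    (Wd₁ : WeierstrassCurve ℚ) [Wd₁.IsElliptic] [Wd₁.IsGloballyMinimal]
    (hWd₁ : ∃ C : VariableChange ℚ, C • W.quadraticTwist (NumberField.discr K₁ : ℚ) = Wd₁)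
    (hrd₁ : Wd₁.analyticRank = 1) (hSel₁ : Nat.card (Wd₁.selmerGroup 2) = 2) (hDEF₁ : padicValNat 2 Wd₁.tamagawaProduct ≤ 1)
    (q₀ q₁ : ℚ) (hq₀ : shaAn Wd₀ = (q₀ : ℂ)) (hq₁ : shaAn Wd₁ = (q₁ : ℂ)) :
    2 * (M₀ : ℤ) - 2 * (M₁ : ℤ) =
      (padicValRat 2 q₀ + (padicValNat 2 Wd₀.tamagawaProduct : ℤ)) - (padicValRat 2 q₁ + (padicValNat 2 Wd₁.tamagawaProduct : ℤ)) := by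
  sorry

/-- **F4⁻ — THE OFF-CUT RESIDUAL (stub, rank 3).**  K₄⁻ VERBATIM on the curves of the cell with NO odd prime of multiplicative reduction, where the
LEAD's `ℚ`-currency theorems (which need a multiplicative prime `v ∤ 2` for Q2) are not available.  Honest residual of the line (cf. 31767
`OffCutResidualAtTwoR` on the COUNT side).  Why it might fail: as K₄⁻ itself, on a thinner class. [cite: Kolyvagin1989Izv, Thm. B₂] -/
theorem stub_offCut
    (W : WeierstrassCurve ℚ) [W.IsElliptic] [W.IsGloballyMinimal] [NeZero (W.conductorNorm ℤ)]
    (hcm : ¬ W.HasCM) (hr0 : W.analyticRank = 0) (hρ : ∀ n : ℕ, 0 < n → W.HasSurjectiveModNGaloisRep ((2 : ℤ) ^ n))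
    (hT : Odd W.tamagawaProduct) (hneg : W.Δ < 0) (h4 : Nat.card (W.selmerGroup 2) = 4)
    (hoff : ¬ ∃ v : HeightOneSpectrum (𝓞 ℚ), ((2 : ℕ) : 𝓞 ℚ) ∉ v.asIdeal ∧ ((W.conductorNorm ℤ : ℕ) : 𝓞 ℚ) ∈ v.asIdeal ∧
      W.HasMultiplicativeReductionAt v)
    (K : Type) [Field K] [NumberField K] (hIQ : IsImaginaryQuadratic K) (hodd : Odd (NumberField.discr K))
    (h3 : NumberField.discr K ≠ -3) (hHe : SatisfiesHeegnerHypothesis (W.conductorNorm ℤ) K)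
    (hsq1 : ¬ IsSquare ((NumberField.discr K : ℚ) * -|W.Δ|)) (hsq2 : ¬ IsSquare ((NumberField.discr K : ℚ) * (-(2 * |W.Δ|))))
    (ℓ : ℕ) (hℓ : ℓ.Prime) (hdK : NumberField.discr K = -(ℓ : ℤ))
    (h2K : ((Ideal.span {(2 : ℤ)}).primesOver (𝓞 K)).ncard = 2)
    (Dt : ModularParametrizationData W (W.conductorNorm ℤ))
    (hopt : ∀ z ∈ Dt.L.lattice, ∃ w ∈ periodLattice Dt.f, z = (Dt.c : ℂ) * w) (hc : Odd Dt.c)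
    (β : ℤ) (ι : K →+* ℂ) (d₁ : KolyvaginHeegnerData Dt β ι 1) (hy : ¬ IsOfFinAddOrder d₁.derivedPoint)
    (M₀ : ℕ) (hdiv : ∃ Q : (W.baseChange (ringClassField K ι 1)).toAffine.Point, ((2 ^ M₀ : ℕ) : ℤ) • Q = d₁.derivedPoint)
    (hndiv : ¬ ∃ Q : (W.baseChange (ringClassField K ι 1)).toAffine.Point, ((2 ^ (M₀ + 1) : ℕ) : ℤ) • Q = d₁.derivedPoint)
    (hM₀ : 1 ≤ M₀)
    (Wd : WeierstrassCurve ℚ) [Wd.IsElliptic] [Wd.IsGloballyMinimal]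
    (hWd : ∃ C : VariableChange ℚ, C • W.quadraticTwist (NumberField.discr K : ℚ) = Wd)
    (hrd : Wd.analyticRank = 1) (hSel : Nat.card (Wd.selmerGroup 2) = 2) (hDEF : padicValNat 2 Wd.tamagawaProduct ≤ 1) :
    ∃ (n : ℕ) (d : KolyvaginHeegnerData Dt β ι n), Squarefree n ∧
      (∀ ℓ ∈ n.primeFactors, Zhang2014.IsKolyvaginPrime (W.conductorNorm ℤ) W K 2 ℓ ∧ 2 ≤ Zhang2014.kolyvaginIndex W 2 ℓ ∧
        FrobEqFrobInfty W K 2 ℓ) ∧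
      ¬ ∃ Q : (W.baseChange (ringClassField K ι n)).toAffine.Point, (2 : ℤ) • Q = d.derivedPoint := by
  sorry

/-! ## §2 F2⁻ (depth rigidity across admissible prime frames) DERIVED — no `sorry` of its own — from the ROUTE ITEM U₂ `MinimalTwinBSDTwo` (stmt-22985),
the print ledger F2L⁻ and the PARITY step on the Tamagawa budgets `ord₂ C(Wd_i) ≤ 1`: `2·(M₀ − M₁) = t₀ − t₁ ∈ {−1, 0, 1}` forces `M₀ = M₁`. -/

/-- **F2⁻ from U₂ + F2L⁻ + parity: two admissible prime frames of a K₄⁻-cell curve have the same exact Heegner depth, `M₀ = M₁`**, modulo the route item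
`MinimalTwinBSDTwo` and the four print items (no cut hypothesis needed). [cite: GrossZagier1986, V §2 (2.2)] [cite: Miller2011LMS, Def. 1.1] -/
theorem depthRigidity_of_minimalTwinBSDTwo (hTw : MinimalTwinBSDTwo) (hGZ : GrossZagierAllLevels) (hGZK : MultPublishedInputsAtTwo)
    (hL : EntireLFunctionRat) (hMi : MilneAnyModel)
    (W : WeierstrassCurve ℚ) [W.IsElliptic] [W.IsGloballyMinimal] [NeZero (W.conductorNorm ℤ)]
    (hcm : ¬ W.HasCM) (hr0 : W.analyticRank = 0) (hρ : ∀ n : ℕ, 0 < n → W.HasSurjectiveModNGaloisRep ((2 : ℤ) ^ n))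
    (hT : Odd W.tamagawaProduct) (hneg : W.Δ < 0) (h4 : Nat.card (W.selmerGroup 2) = 4)
    (Dt : ModularParametrizationData W (W.conductorNorm ℤ))
    (hopt : ∀ z ∈ Dt.L.lattice, ∃ w ∈ periodLattice Dt.f, z = (Dt.c : ℂ) * w) (hc : Odd Dt.c)
    (K₀ : Type) [Field K₀] [NumberField K₀] (hIQ₀ : IsImaginaryQuadratic K₀) (hodd₀ : Odd (NumberField.discr K₀))
    (h3₀ : NumberField.discr K₀ ≠ -3) (hHe₀ : SatisfiesHeegnerHypothesis (W.conductorNorm ℤ) K₀)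
    (hsq1₀ : ¬ IsSquare ((NumberField.discr K₀ : ℚ) * -|W.Δ|)) (hsq2₀ : ¬ IsSquare ((NumberField.discr K₀ : ℚ) * (-(2 * |W.Δ|))))
    (ℓ₀ : ℕ) (hℓ₀ : ℓ₀.Prime) (hdK₀ : NumberField.discr K₀ = -(ℓ₀ : ℤ))
    (h2K₀ : ((Ideal.span {(2 : ℤ)}).primesOver (𝓞 K₀)).ncard = 2)
    (β₀ : ℤ) (ι₀ : K₀ →+* ℂ) (d₀ : KolyvaginHeegnerData Dt β₀ ι₀ 1) (hy₀ : ¬ IsOfFinAddOrder d₀.derivedPoint)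
    (M₀ : ℕ) (hdiv₀ : ∃ Q : (W.baseChange (ringClassField K₀ ι₀ 1)).toAffine.Point, ((2 ^ M₀ : ℕ) : ℤ) • Q = d₀.derivedPoint)
    (hndiv₀ : ¬ ∃ Q : (W.baseChange (ringClassField K₀ ι₀ 1)).toAffine.Point, ((2 ^ (M₀ + 1) : ℕ) : ℤ) • Q = d₀.derivedPoint)
    (hM₀ : 1 ≤ M₀)
    (Wd₀ : WeierstrassCurve ℚ) [Wd₀.IsElliptic] [Wd₀.IsGloballyMinimal]
    (hWd₀ : ∃ C : VariableChange ℚ, C • W.quadraticTwist (NumberField.discr K₀ : ℚ) = Wd₀)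
    (hrd₀ : Wd₀.analyticRank = 1) (hSel₀ : Nat.card (Wd₀.selmerGroup 2) = 2) (hDEF₀ : padicValNat 2 Wd₀.tamagawaProduct ≤ 1)
    (K₁ : Type) [Field K₁] [NumberField K₁] (hIQ₁ : IsImaginaryQuadratic K₁) (hodd₁ : Odd (NumberField.discr K₁))
    (h3₁ : NumberField.discr K₁ ≠ -3) (hHe₁ : SatisfiesHeegnerHypothesis (W.conductorNorm ℤ) K₁)
    (hsq1₁ : ¬ IsSquare ((NumberField.discr K₁ : ℚ) * -|W.Δ|)) (hsq2₁ : ¬ IsSquare ((NumberField.discr K₁ : ℚ) * (-(2 * |W.Δ|))))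
    (ℓ₁ : ℕ) (hℓ₁ : ℓ₁.Prime) (hdK₁ : NumberField.discr K₁ = -(ℓ₁ : ℤ))
    (h2K₁ : ((Ideal.span {(2 : ℤ)}).primesOver (𝓞 K₁)).ncard = 2)
    (β₁ : ℤ) (ι₁ : K₁ →+* ℂ) (d₁ : KolyvaginHeegnerData Dt β₁ ι₁ 1) (hy₁ : ¬ IsOfFinAddOrder d₁.derivedPoint)
    (M₁ : ℕ) (hdiv₁ : ∃ Q : (W.baseChange (ringClassField K₁ ι₁ 1)).toAffine.Point, ((2 ^ M₁ : ℕ) : ℤ) • Q = d₁.derivedPoint)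
    (hndiv₁ : ¬ ∃ Q : (W.baseChange (ringClassField K₁ ι₁ 1)).toAffine.Point, ((2 ^ (M₁ + 1) : ℕ) : ℤ) • Q = d₁.derivedPoint)
    (hM₁ : 1 ≤ M₁)
    (Wd₁ : WeierstrassCurve ℚ) [Wd₁.IsElliptic] [Wd₁.IsGloballyMinimal]
    (hWd₁ : ∃ C : VariableChange ℚ, C • W.quadraticTwist (NumberField.discr K₁ : ℚ) = Wd₁)
    (hrd₁ : Wd₁.analyticRank = 1) (hSel₁ : Nat.card (Wd₁.selmerGroup 2) = 2) (hDEF₁ : padicValNat 2 Wd₁.tamagawaProduct ≤ 1) :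
    M₀ = M₁ := by
  obtain ⟨q₀, hq₀, hv₀⟩ := unitSha_of_bsdp Wd₀ (hTw Wd₀ (not_hasCM_twin W hcm K₀ Wd₀ hWd₀) hrd₀ hSel₀) hrd₀ hSel₀
  obtain ⟨q₁, hq₁, hv₁⟩ := unitSha_of_bsdp Wd₁ (hTw Wd₁ (not_hasCM_twin W hcm K₁ Wd₁ hWd₁) hrd₁ hSel₁) hrd₁ hSel₁
  have hLdg := stub_twoFrameLedger hGZ hGZK hL hMi W hcm hr0 hρ hT hneg h4 Dt hopt hc K₀ hIQ₀ hodd₀ h3₀ hHe₀ hsq1₀ hsq2₀ ℓ₀ hℓ₀ hdK₀ h2K₀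
    β₀ ι₀ d₀ hy₀ M₀ hdiv₀ hndiv₀ hM₀ Wd₀ hWd₀ hrd₀ hSel₀ hDEF₀ K₁ hIQ₁ hodd₁ h3₁ hHe₁ hsq1₁ hsq2₁ ℓ₁ hℓ₁ hdK₁ h2K₁ β₁ ι₁ d₁ hy₁ M₁
    hdiv₁ hndiv₁ hM₁ Wd₁ hWd₁ hrd₁ hSel₁ hDEF₁ q₀ q₁ hq₀ hq₁
  rw [hv₀, hv₁] at hLdg
  have ht₀ : (padicValNat 2 Wd₀.tamagawaProduct : ℤ) ≤ 1 := by exact_mod_cast hDEF₀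
  have ht₁ : (padicValNat 2 Wd₁.tamagawaProduct : ℤ) ≤ 1 := by exact_mod_cast hDEF₁
  omega

/-! ## §3 LOSSLESSNESS (kernel-checked, mod Q2): K₄⁻ ⟹ F1⁻ on the cut — so, modulo Q2, U₂ and PRINT, K₄⁻ on the cut at depth `≥ 2` is EQUIVALENT to F1⁻. -/

/-- **K₄⁻ ⟹ F1⁻** (take `K₁ := K₀`; the currency `.mp` turns the witness into the count).  Mod Q2. -/
theorem frameAttainment_of_K4Neg (hQ2 : KolyvaginRelationAtTwo)
    (hK4 : Summit.BirchSwinnertonDyer.BirchSwinnertonDyer.Theses.GenusKolyvaginAtTwo.K4Neg)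
    (W : WeierstrassCurve ℚ) [W.IsElliptic] [W.IsGloballyMinimal] [NeZero (W.conductorNorm ℤ)]
    (hcm : ¬ W.HasCM) (hr0 : W.analyticRank = 0) (hρ : ∀ n : ℕ, 0 < n → W.HasSurjectiveModNGaloisRep ((2 : ℤ) ^ n))
    (hT : Odd W.tamagawaProduct) (hneg : W.Δ < 0) (h4 : Nat.card (W.selmerGroup 2) = 4)
    (v : HeightOneSpectrum (𝓞 ℚ)) (h2v : ((2 : ℕ) : 𝓞 ℚ) ∉ v.asIdeal)
    (hNv : ((W.conductorNorm ℤ : ℕ) : 𝓞 ℚ) ∈ v.asIdeal) (hmult : W.HasMultiplicativeReductionAt v)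
    (K₀ : Type) [Field K₀] [NumberField K₀] (hIQ₀ : IsImaginaryQuadratic K₀) (hodd₀ : Odd (NumberField.discr K₀))
    (h3₀ : NumberField.discr K₀ ≠ -3) (hHe₀ : SatisfiesHeegnerHypothesis (W.conductorNorm ℤ) K₀)
    (hsq1₀ : ¬ IsSquare ((NumberField.discr K₀ : ℚ) * -|W.Δ|)) (hsq2₀ : ¬ IsSquare ((NumberField.discr K₀ : ℚ) * (-(2 * |W.Δ|))))
    (ℓ₀ : ℕ) (hℓ₀ : ℓ₀.Prime) (hdK₀ : NumberField.discr K₀ = -(ℓ₀ : ℤ))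
    (h2K₀ : ((Ideal.span {(2 : ℤ)}).primesOver (𝓞 K₀)).ncard = 2)
    (Dt : ModularParametrizationData W (W.conductorNorm ℤ))
    (hopt : ∀ z ∈ Dt.L.lattice, ∃ w ∈ periodLattice Dt.f, z = (Dt.c : ℂ) * w) (hc : Odd Dt.c)
    (β₀ : ℤ) (ι₀ : K₀ →+* ℂ) (d₀ : KolyvaginHeegnerData Dt β₀ ι₀ 1) (hy₀ : ¬ IsOfFinAddOrder d₀.derivedPoint)
    (M₀ : ℕ) (hdiv₀ : ∃ Q : (W.baseChange (ringClassField K₀ ι₀ 1)).toAffine.Point, ((2 ^ M₀ : ℕ) : ℤ) • Q = d₀.derivedPoint)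
    (hndiv₀ : ¬ ∃ Q : (W.baseChange (ringClassField K₀ ι₀ 1)).toAffine.Point, ((2 ^ (M₀ + 1) : ℕ) : ℤ) • Q = d₀.derivedPoint)
    (hM₀ : 1 ≤ M₀) (hM₀2 : 2 ≤ M₀)
    (Wd₀ : WeierstrassCurve ℚ) [Wd₀.IsElliptic] [Wd₀.IsGloballyMinimal]
    (hWd₀ : ∃ C : VariableChange ℚ, C • W.quadraticTwist (NumberField.discr K₀ : ℚ) = Wd₀)
    (hrd₀ : Wd₀.analyticRank = 1) (hSel₀ : Nat.card (Wd₀.selmerGroup 2) = 2) (hDEF₀ : padicValNat 2 Wd₀.tamagawaProduct ≤ 1) :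
    ∃ (K₁ : Type) (_ : Field K₁) (_ : NumberField K₁),
      IsImaginaryQuadratic K₁ ∧ Odd (NumberField.discr K₁) ∧ NumberField.discr K₁ ≠ -3 ∧
      SatisfiesHeegnerHypothesis (W.conductorNorm ℤ) K₁ ∧
      ¬ IsSquare ((NumberField.discr K₁ : ℚ) * -|W.Δ|) ∧ ¬ IsSquare ((NumberField.discr K₁ : ℚ) * (-(2 * |W.Δ|))) ∧
      ∃ (ℓ₁ : ℕ), ℓ₁.Prime ∧ NumberField.discr K₁ = -(ℓ₁ : ℤ) ∧ ((Ideal.span {(2 : ℤ)}).primesOver (𝓞 K₁)).ncard = 2 ∧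
      ∃ (β₁ : ℤ) (ι₁ : K₁ →+* ℂ) (d₁ : KolyvaginHeegnerData Dt β₁ ι₁ 1), ¬ IsOfFinAddOrder d₁.derivedPoint ∧
      ∃ (M₁ : ℕ), (∃ Q : (W.baseChange (ringClassField K₁ ι₁ 1)).toAffine.Point, ((2 ^ M₁ : ℕ) : ℤ) • Q = d₁.derivedPoint) ∧
        (¬ ∃ Q : (W.baseChange (ringClassField K₁ ι₁ 1)).toAffine.Point, ((2 ^ (M₁ + 1) : ℕ) : ℤ) • Q = d₁.derivedPoint) ∧ 1 ≤ M₁ ∧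
        (∃ (Wd₁ : WeierstrassCurve ℚ) (_ : Wd₁.IsElliptic) (_ : Wd₁.IsGloballyMinimal),
          (∃ C : VariableChange ℚ, C • W.quadraticTwist (NumberField.discr K₁ : ℚ) = Wd₁) ∧ Wd₁.analyticRank = 1 ∧
          Nat.card (Wd₁.selmerGroup 2) = 2 ∧ padicValNat 2 Wd₁.tamagawaProduct ≤ 1) ∧
        Nat.card (AddCommGroup.primaryComponent (↥W.sha) 2) = 2 ^ (2 * M₁) := by
  have hw := hK4 W hcm hr0 hρ hT hneg h4 K₀ hIQ₀ hodd₀ h3₀ hHe₀ hsq1₀ hsq2₀ ℓ₀ hℓ₀ hdK₀ h2K₀ Dt hopt hc β₀ ι₀ d₀ hy₀ M₀ hdiv₀ hndiv₀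
    hM₀ Wd₀ hWd₀ hrd₀ hSel₀ hDEF₀
  have hY := (kFourNeg_conclusion_iff_natCard_sha_rat_eq_pow hQ2 W hcm hr0 hρ hT hneg h4 K₀ hIQ₀ hodd₀ h3₀ hHe₀ hsq1₀ hsq2₀ ℓ₀ hℓ₀
    hdK₀ h2K₀ Dt hopt hc β₀ ι₀ d₀ hy₀ M₀ hdiv₀ hndiv₀ hM₀ Wd₀ hWd₀ hrd₀ hSel₀ hDEF₀ v h2v hNv hmult).mp hw
  exact ⟨K₀, inferInstance, inferInstance, hIQ₀, hodd₀, h3₀, hHe₀, hsq1₀, hsq2₀, ℓ₀, hℓ₀, hdK₀, h2K₀, β₀, ι₀, d₀, hy₀, M₀, hdiv₀,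
    hndiv₀, hM₀, ⟨Wd₀, inferInstance, inferInstance, hWd₀, hrd₀, hSel₀, hDEF₀⟩, hY⟩

/-- **COMPOSITION (kernel-checked; no `sorry` of its own): F1⁻ → F2L⁻ → F4⁻ → K₄⁻, modulo Q2 and U₂ (`MinimalTwinBSDTwo`).**  Off the cut: F4⁻.  On the cut
at depth `M₀ = 1`: the LEAD's `kFourNeg_conclusion_of_depth_one_of_hasMultiplicativeReductionAt` BY NAME (item 33814, CLOSED proved).  On the cut at depth
`M₀ ≥ 2`: F1⁻ supplies an admissible prime frame `K₁` with `#Ш(E/ℚ)[2^∞] = 2^(2·M₁)`; F2⁻ — DERIVED from U₂ + F2L⁻ + parity — gives `M₀ = M₁`; the LEAD's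
currency `kFourNeg_conclusion_iff_natCard_sha_rat_eq_pow` (mod Q2 only) at the ORIGINAL frame `K`, direction `.mpr`, is the K₄⁻ witness.  K4Neg is NOT
proved (the stubs are open, Q2 and U₂ are open route items); no summit is proved by a line. -/
theorem K4Neg_of (hQ2 : KolyvaginRelationAtTwo) (hTw : MinimalTwinBSDTwo) (hGZ : GrossZagierAllLevels) (hGZK : MultPublishedInputsAtTwo)
    (hL : EntireLFunctionRat) (hMi : MilneAnyModel) :
    Summit.BirchSwinnertonDyer.BirchSwinnertonDyer.Theses.GenusKolyvaginAtTwo.K4Neg := by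
  intro W _ _ _ hcm hr0 hρ hT hneg h4 K _ _ hIQ hodd h3 hHe hsq1 hsq2 ℓ₀ hℓ₀ hdK h2K Dt hopt hc β ι d₁ hy M₀ hdiv hndiv hM₀ Wd _ _ hWd
    hrd hSel hDEF
  by_cases hcut : ∃ v : HeightOneSpectrum (𝓞 ℚ), ((2 : ℕ) : 𝓞 ℚ) ∉ v.asIdeal ∧ ((W.conductorNorm ℤ : ℕ) : 𝓞 ℚ) ∈ v.asIdeal ∧
      W.HasMultiplicativeReductionAt v
  swap
  · exact stub_offCut W hcm hr0 hρ hT hneg h4 hcut K hIQ hodd h3 hHe hsq1 hsq2 ℓ₀ hℓ₀ hdK h2K Dt hopt hc β ι d₁ hy M₀ hdiv hndiv hM₀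
      Wd hWd hrd hSel hDEF
  obtain ⟨v, h2v, hNv, hmult⟩ := hcut
  -- depth ONE on the cut: the LEAD's theorem (item 33814 `K4NegDepthOneOnCut`), by name
  by_cases h1 : M₀ = 1
  · exact Summit.BirchSwinnertonDyer.BirchSwinnertonDyer.Theorems.GenusExact.PlusDescent.kFourNeg_conclusion_of_depth_one_of_hasMultiplicativeReductionAt
      hQ2 W hcm hr0 hρ hT hneg h4 v h2v hNv hmult K hIQ hodd h3 hHe hsq1 hsq2 ℓ₀ hℓ₀ hdK h2K Dt hopt hc β ι d₁ hy M₀ hdiv hndiv h1 Wd hWd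
      hrd hSel hDEF
  have hM₀2 : 2 ≤ M₀ := by omega
  -- F1⁻: an admissible prime frame `K₁` of `E` whose depth `M₁` attains the `Ш`-exponent
  obtain ⟨K₁, _instF, _instNF, hIQ₁, hodd₁, h3₁, hHe₁, hsq1₁, hsq2₁, ℓ₁, hℓ₁, hdK₁, h2K₁, β₁, ι₁, e₁, hy₁, M₁, hdiv₁, hndiv₁, hM₁,
      ⟨Wd₁, _instE₁, _instG₁, hWd₁, hrd₁, hSel₁, hDEF₁⟩, hY⟩ :=
    stub_frameAttainment W hcm hr0 hρ hT hneg h4 v h2v hNv hmult K hIQ hodd h3 hHe hsq1 hsq2 ℓ₀ hℓ₀ hdK h2K Dt hopt hc β ι d₁ hy M₀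
      hdiv hndiv hM₀ hM₀2 Wd hWd hrd hSel hDEF
  -- F2⁻ (derived from U₂ + F2L⁻ + parity): the depth is rigid across the two frames
  have hMM : M₀ = M₁ :=
    depthRigidity_of_minimalTwinBSDTwo hTw hGZ hGZK hL hMi W hcm hr0 hρ hT hneg h4 Dt hopt hc K hIQ hodd h3 hHe hsq1 hsq2 ℓ₀ hℓ₀ hdK h2K β ι
      d₁ hy M₀ hdiv hndiv hM₀ Wd hWd hrd hSel hDEF K₁ hIQ₁ hodd₁ h3₁ hHe₁ hsq1₁ hsq2₁ ℓ₁ hℓ₁ hdK₁ h2K₁ β₁ ι₁ e₁ hy₁ M₁ hdiv₁ hndiv₁ hM₁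
      Wd₁ hWd₁ hrd₁ hSel₁ hDEF₁
  -- currency at the original frame, direction (count ⟹ witness)
  exact (kFourNeg_conclusion_iff_natCard_sha_rat_eq_pow hQ2 W hcm hr0 hρ hT hneg h4 K hIQ hodd h3 hHe hsq1 hsq2 ℓ₀ hℓ₀ hdK h2K Dt
    hopt hc β ι d₁ hy M₀ hdiv hndiv hM₀ Wd hWd hrd hSel hDEF v h2v hNv hmult).mpr (by rw [hMM]; exact hY)

/-! ## §4 (v1.1) THE STUB-FREE ROAD ON THE CUT — K₄⁻|cut ⟸ WALL row 1 + U₂ + Q2 + PRINT with NO `sorry`; K₄⁻ ⟸ the same + F4 only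

The LEAD's LEAF CURRENCY `GenusSupplyNarrow.KFourCell.LeafCurrency.kFourNeg_conclusion_iff_bsdp` (file `…GenusDeepSupplyAtTwoNegDiscNarrowKFourCellLeafCurrency`):
on a K₄⁻ frame WITH an odd multiplicative prime, GIVEN `BSDp Wd 2`, Q2 and the four PRINT items, **the K₄⁻ conclusion at `E` ↔ `BSDp W 2`**.  Feeding it
`BSDp W 2` from WALL row 1 (the four `ByReductionTypeAtTwo` rows 19095–19098 BY NAME, reduction-type tetrachotomy at `2`) and `BSDp Wd 2` from U₂
(`MinimalTwinBSDTwo` 22985 BY NAME: the twin is non-CM, `r_an = 1`, `#Sel₂ = 2`) gives the conclusion ON THE CUT with NO stub and NO `sorry`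
(`onCut_of_wall_U2`, audit `closed = true` = sorry-free; its TYPE carries the four WALL rows, U₂, Q2 and PRINT as HYPOTHESES — all OPEN / print
route items).  CONSEQUENCE FOR THIS LINE AND FOR LINE 32: the stubs F1 (frame attainment), F2L (two-frame ledger) — and LINE 32's F2T — are
ALL DOMINATED by WALL row 1 + U₂ (given Q2 + PRINT), kernel-certified: the critic's booking #504/#511 P1 («F1 = WALL») is now a theorem of the
tree's items, and the ONLY content of K₄⁻ outside {WALL row 1, U₂, Q2, PRINT} is F4 = the OFF-CUT residual (`K4Neg_of_wall_U2` below: one stub).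
`K4Neg` is NOT proved; BSD is not proved; no summit is proved by a line. -/

open Summit.BirchSwinnertonDyer.BirchSwinnertonDyer.Theses.ByReductionTypeAtTwo
  (GoodOrdinaryRankZeroAtTwo MultiplicativeRankZeroAtTwo SupersingularRankZeroAtTwo AdditiveRankZeroAtTwo) in
/-- `BSD₂(E)` for a non-CM rank-`0` curve from the four WALL rows of `ByReductionTypeAtTwo` (tetrachotomy of the reduction type at `2`), by name.
Sorry-free bookkeeping. [cite: Miller2011LMS, Def. 1.1] -/
theorem bsdp_of_wallRows (hOrd : GoodOrdinaryRankZeroAtTwo) (hMult : MultiplicativeRankZeroAtTwo)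
    (hSS : SupersingularRankZeroAtTwo) (hAdd : AdditiveRankZeroAtTwo)
    (W : WeierstrassCurve ℚ) [W.IsElliptic] [W.IsGloballyMinimal] (hcm : ¬ W.HasCM) (hr0 : W.analyticRank = 0) : BSDp W 2 := by
  haveI : Fact (Nat.Prime 2) := ⟨Nat.prime_two⟩
  by_cases hg : W.HasGoodReductionAtPrime 2
  · by_cases hd : ((2 : ℕ) : ℤ) ∣ W.frobeniusTrace 2
    · exact hSS W hcm hr0 ⟨hg, hd⟩
    · exact hOrd W hcm hr0 ⟨hg, hd⟩
  · by_cases hm : W.HasMultiplicativeReductionAtPrime 2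
    · exact hMult W hcm hr0 hm
    · exact hAdd W hcm hr0 ⟨hg, hm⟩

open Summit.BirchSwinnertonDyer.BirchSwinnertonDyer.Theses.ByReductionTypeAtTwo
  (GoodOrdinaryRankZeroAtTwo MultiplicativeRankZeroAtTwo SupersingularRankZeroAtTwo AdditiveRankZeroAtTwo) in
/-- **K₄⁻ ON THE CUT ⟸ WALL row 1 + U₂ + Q2 + PRINT — NO stub, NO `sorry` (v1.1).**  The K₄⁻ frame binders VERBATIM with the off-cut hypothesis
replaced by an odd multiplicative prime `v`; proof = the LEAD's leaf currency, direction `.mpr`, fed by `bsdp_of_wallRows` and U₂.  Nothing is closed: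
the hypotheses are OPEN / print route items. [cite: McCallumLMS1991, §5 Thm. 5.4] [cite: GrossZagier1986, V.§2 (2.2)] [cite: Miller2011LMS, Def. 1.1] -/
theorem onCut_of_wall_U2 (hOrd : GoodOrdinaryRankZeroAtTwo) (hMult : MultiplicativeRankZeroAtTwo)
    (hSS : SupersingularRankZeroAtTwo) (hAdd : AdditiveRankZeroAtTwo) (hTw : MinimalTwinBSDTwo) (hQ2 : KolyvaginRelationAtTwo)
    (hGZ : GrossZagierAllLevels) (hGZK : MultPublishedInputsAtTwo) (hL : EntireLFunctionRat) (hMi : MilneAnyModel)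
    (W : WeierstrassCurve ℚ) [W.IsElliptic] [W.IsGloballyMinimal] [NeZero (W.conductorNorm ℤ)]
    (hcm : ¬ W.HasCM) (hr0 : W.analyticRank = 0) (hρ : ∀ n : ℕ, 0 < n → W.HasSurjectiveModNGaloisRep ((2 : ℤ) ^ n))
    (hT : Odd W.tamagawaProduct) (hneg : W.Δ < 0) (h4 : Nat.card (W.selmerGroup 2) = 4)
    (v : HeightOneSpectrum (𝓞 ℚ)) (h2v : ((2 : ℕ) : 𝓞 ℚ) ∉ v.asIdeal)
    (hNv : ((W.conductorNorm ℤ : ℕ) : 𝓞 ℚ) ∈ v.asIdeal) (hmult : W.HasMultiplicativeReductionAt v)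
    (K : Type) [Field K] [NumberField K] (hIQ : IsImaginaryQuadratic K) (hodd : Odd (NumberField.discr K))
    (h3 : NumberField.discr K ≠ -3) (hHe : SatisfiesHeegnerHypothesis (W.conductorNorm ℤ) K)
    (hsq1 : ¬ IsSquare ((NumberField.discr K : ℚ) * -|W.Δ|)) (hsq2 : ¬ IsSquare ((NumberField.discr K : ℚ) * (-(2 * |W.Δ|))))
    (ℓ : ℕ) (hℓ : ℓ.Prime) (hdK : NumberField.discr K = -(ℓ : ℤ))
    (h2K : ((Ideal.span {(2 : ℤ)}).primesOver (𝓞 K)).ncard = 2)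
    (Dt : ModularParametrizationData W (W.conductorNorm ℤ))
    (hopt : ∀ z ∈ Dt.L.lattice, ∃ w ∈ periodLattice Dt.f, z = (Dt.c : ℂ) * w) (hc : Odd Dt.c)
    (β : ℤ) (ι : K →+* ℂ) (d₁ : KolyvaginHeegnerData Dt β ι 1) (hy : ¬ IsOfFinAddOrder d₁.derivedPoint)
    (M₀ : ℕ) (hdiv : ∃ Q : (W.baseChange (ringClassField K ι 1)).toAffine.Point, ((2 ^ M₀ : ℕ) : ℤ) • Q = d₁.derivedPoint)
    (hndiv : ¬ ∃ Q : (W.baseChange (ringClassField K ι 1)).toAffine.Point, ((2 ^ (M₀ + 1) : ℕ) : ℤ) • Q = d₁.derivedPoint)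
    (hM₀ : 1 ≤ M₀)
    (Wd : WeierstrassCurve ℚ) [Wd.IsElliptic] [Wd.IsGloballyMinimal]
    (hWd : ∃ C : VariableChange ℚ, C • W.quadraticTwist (NumberField.discr K : ℚ) = Wd)
    (hrd : Wd.analyticRank = 1) (hSel : Nat.card (Wd.selmerGroup 2) = 2) (hDEF : padicValNat 2 Wd.tamagawaProduct ≤ 1) :
    ∃ (n : ℕ) (d : KolyvaginHeegnerData Dt β ι n), Squarefree n ∧
      (∀ ℓ ∈ n.primeFactors, Zhang2014.IsKolyvaginPrime (W.conductorNorm ℤ) W K 2 ℓ ∧ 2 ≤ Zhang2014.kolyvaginIndex W 2 ℓ ∧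
        FrobEqFrobInfty W K 2 ℓ) ∧
      ¬ ∃ Q : (W.baseChange (ringClassField K ι n)).toAffine.Point, (2 : ℤ) • Q = d.derivedPoint := by
  have hBW : BSDp W 2 := bsdp_of_wallRows hOrd hMult hSS hAdd W hcm hr0
  have hBd : BSDp Wd 2 := hTw Wd (not_hasCM_twin W hcm K Wd hWd) hrd hSel
  exact (Summit.BirchSwinnertonDyer.BirchSwinnertonDyer.Theorems.GenusSupplyNarrow.KFourCell.LeafCurrency.kFourNeg_conclusion_iff_bsdp hGZ hL hGZK hMi hQ2 W hcm hr0 hρ hT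
    hneg h4 K hIQ hodd h3 hHe hsq1 hsq2 ℓ hℓ hdK h2K Dt hopt hc β ι d₁ hy M₀ hdiv hndiv hM₀ Wd hWd hrd hSel hDEF v h2v hNv hmult hBd).mpr hBW

open Summit.BirchSwinnertonDyer.BirchSwinnertonDyer.Theses.ByReductionTypeAtTwo
  (GoodOrdinaryRankZeroAtTwo MultiplicativeRankZeroAtTwo SupersingularRankZeroAtTwo AdditiveRankZeroAtTwo) in
/-- **K₄⁻ ⟸ WALL row 1 + U₂ + Q2 + PRINT + F4 (the off-cut stub ONLY) — v1.1 composition; F1 and F2L are no longer on the path.**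
`K4Neg` is NOT proved (F4 is open; WALL row 1, U₂, Q2 are OPEN route items); no summit is proved by a line. -/
theorem K4Neg_of_wall_U2 (hOrd : GoodOrdinaryRankZeroAtTwo) (hMult : MultiplicativeRankZeroAtTwo)
    (hSS : SupersingularRankZeroAtTwo) (hAdd : AdditiveRankZeroAtTwo) (hTw : MinimalTwinBSDTwo) (hQ2 : KolyvaginRelationAtTwo)
    (hGZ : GrossZagierAllLevels) (hGZK : MultPublishedInputsAtTwo) (hL : EntireLFunctionRat) (hMi : MilneAnyModel) :
    Summit.BirchSwinnertonDyer.BirchSwinnertonDyer.Theses.GenusKolyvaginAtTwo.K4Neg := by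
  intro W _ _ _ hcm hr0 hρ hT hneg h4 K _ _ hIQ hodd h3 hHe hsq1 hsq2 ℓ₀ hℓ₀ hdK h2K Dt hopt hc β ι d₁ hy M₀ hdiv hndiv hM₀ Wd _ _ hWd
    hrd hSel hDEF
  by_cases hcut : ∃ v : HeightOneSpectrum (𝓞 ℚ), ((2 : ℕ) : 𝓞 ℚ) ∉ v.asIdeal ∧ ((W.conductorNorm ℤ : ℕ) : 𝓞 ℚ) ∈ v.asIdeal ∧
      W.HasMultiplicativeReductionAt v
  swap
  · exact stub_offCut W hcm hr0 hρ hT hneg h4 hcut K hIQ hodd h3 hHe hsq1 hsq2 ℓ₀ hℓ₀ hdK h2K Dt hopt hc β ι d₁ hy M₀ hdiv hndiv hM₀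
      Wd hWd hrd hSel hDEF
  obtain ⟨v, h2v, hNv, hmult⟩ := hcut
  exact onCut_of_wall_U2 hOrd hMult hSS hAdd hTw hQ2 hGZ hGZK hL hMi W hcm hr0 hρ hT hneg h4 v h2v hNv hmult K hIQ hodd h3 hHe hsq1 hsq2 ℓ₀ hℓ₀ hdK h2K Dt hopt hc β ι d₁ hy M₀ hdiv hndiv hM₀ Wd hWd hrd hSel hDEF

/-! ## §5 (v1.2) OFF THE CUT: F4 ⟸ WALL row 1 + U₂ + Q2 + PRINT + F4′, where F4′ = «NO LOCALLY-TRIVIAL PHANTOM CLASSES» (NPh_K) — the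
LEAD's hypothesis (NPh_K) of the master halving descent B2Q♭, which the tree discharges ONLY on the multiplicative cut
(`NonPhantomPow.nonPhantomAtTwo_of_hasMultiplicativeReductionAt`; LINE 18's registered `stub_nonPhantomAtTwo` was closed by threading that binder).
So the K₄⁻ conclusion at an OFF-CUT frame follows from `BSD₂(E)` (WALL rows) + `BSD₂(Wd)` (U₂) + PRINT (pair ledger ⟹ `#Ш(E/K)[2^∞] = 4^(M₀)` ⟹
a class of order `2^(M₀)` in `Ш(E/ℚ)`, `PlusDescent.exists_mem_sha_two_pow_pred_smul_ne_zero_of_natCard_eq_pow`, no cut) + Q2 + (NPh_K) (the master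
`PlusDescent.exists_primitive_of_two_pow_pred_smul_ne_zero_of_nonPhantom_of_pairSupply` + `pairSupply_frobEqFrobInfty_of_Δ_neg`, no cut).  NEW STUB F4′ `stub_offCutNonPhantom` (curve-and-field level, no datum):
(NPh_K) for the off-cut K₄⁻ cell.  COMPOSITION `K4Neg_of_wall_U2_nonPhantom`: its ONLY stub is F4″ (v1.3; F4′ in v1.2).  READING: modulo the route's own items
{WALL row 1, U₂, Q2, PRINT} the ENTIRE content of `K4Neg` is (NPh_K) off the cut — a statement of pure Galois cohomology of `E[2^L]` over `K`
(Lawson–Wuthrich), with no L-value, no Heegner point and no `Ш` in it.  `K4Neg` is NOT proved; nothing is closed; no summit is proved by a line.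
[cite: LawsonWuthrich2016, §7.1, §8] [cite: McCallumLMS1991, §5 Thm. 5.4] -/


/-- **The K₄⁻ SHAPE off the cut from ONE sharp Selmer class, modulo Q2 and (NPh_K)** — the LEAD's packaging
(`kFourNeg_shape_of_two_pow_pred_smul_ne_zero`) with the cut hypothesis replaced by (NPh_K); proof = the LEAD's master theorem BY NAME + bookkeeping.
Sorry-free. [cite: McCallumLMS1991, §5 Thm. 5.4] [cite: Kolyvagin1989Izv, Thm. B₂] -/
theorem kFour_shape_offCut_of_nonPhantom (hQ2 : KolyvaginRelationAtTwo)
    (W : WeierstrassCurve ℚ) [W.IsElliptic] [W.IsGloballyMinimal] [NeZero (W.conductorNorm ℤ)] (hcm : ¬ W.HasCM) (hneg : W.Δ < 0)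
    (hT : Odd W.tamagawaProduct)
    (K : Type) [Field K] [NumberField K] (hIQ : IsImaginaryQuadratic K) (hodd : Odd (NumberField.discr K))
    (h3 : NumberField.discr K ≠ -3) (hHe : SatisfiesHeegnerHypothesis (W.conductorNorm ℤ) K)
    (hsq1 : ¬ IsSquare ((NumberField.discr K : ℚ) * -|W.Δ|))
    (hρ : ∀ n : ℕ, 0 < n → W.HasSurjectiveModNGaloisRep ((2 : ℤ) ^ n))
    (hNPh : ∀ (L : ℕ), 1 ≤ L → ∀ z : galH1Torsion (W.baseChange K) ((2 ^ L : ℕ) : ℤ),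
      (∀ ρ' ∈ torsionFixing (W.baseChange K) ((2 ^ L : ℕ) : ℤ), h1Eval (W.baseChange K) ((2 ^ L : ℕ) : ℤ) z ρ' = 0) →
      (∀ w : HeightOneSpectrum (𝓞 K), z ∈ selmerLocalKer (W.baseChange K) (w.adicCompletion K) ((2 ^ L : ℕ) : ℤ)) → z = 0)
    (Dt : ModularParametrizationData W (W.conductorNorm ℤ)) (β : ℤ) (ι : K →+* ℂ) (d₁ : KolyvaginHeegnerData Dt β ι 1) (M₀ : ℕ)
    (hndiv : ¬ ∃ Q : (W.baseChange (ringClassField K ι 1)).toAffine.Point, ((2 ^ (M₀ + 1) : ℕ) : ℤ) • Q = d₁.derivedPoint)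
    (hw1 : W.rootNumber = 1)
    (hsharp : ∃ (M : ℕ) (s₀ : galH1Torsion W ((2 ^ M : ℕ) : ℤ)), s₀ ∈ selmerGroup W ((2 ^ M : ℕ) : ℤ) ∧ ((2 ^ (M₀ - 1) : ℕ) : ℤ) • s₀ ≠ 0) :
    ∃ (n : ℕ) (d : KolyvaginHeegnerData Dt β ι n), Squarefree n ∧
      (∀ ℓ ∈ n.primeFactors, Zhang2014.IsKolyvaginPrime (W.conductorNorm ℤ) W K 2 ℓ ∧ 2 ≤ Zhang2014.kolyvaginIndex W 2 ℓ ∧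
        FrobEqFrobInfty W K 2 ℓ) ∧
      ¬ ∃ Q : (W.baseChange (ringClassField K ι n)).toAffine.Point, (2 : ℤ) • Q = d.derivedPoint := by
  haveI : Fact (Nat.Prime 2) := ⟨Nat.prime_two⟩
  obtain ⟨M, s₀, hs₀, hne⟩ := hsharp
  have hs2 : W.HasSurjectiveModNGaloisRep 2 := by simpa using hρ 1 one_pos
  -- move `s₀` up to level `2^(M + M₀ + 1)` (the LEAD's bookkeeping, verbatim)
  have hdvd : ((2 ^ M : ℕ) : ℤ) ∣ ((2 ^ (M + M₀ + 1) : ℕ) : ℤ) := by exact_mod_cast pow_dvd_pow 2 (by omega : M ≤ M + M₀ + 1)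
  have hinj : Function.Injective (torsionH1OfDvd W hdvd) :=
    Summit.BirchSwinnertonDyer.BirchSwinnertonDyer.Theorems.GenusExact.VisiblePairAtTwo.torsionH1OfDvd_pow_injective W (p := 2)
      (Summit.BirchSwinnertonDyer.BirchSwinnertonDyer.Theorems.GenusExact.VisiblePairAtTwo.torsionBy_two_eq_bot_of_surj W hs2) hdvd
  have hs₀' : torsionH1OfDvd W hdvd s₀ ∈ selmerGroup W ((2 ^ (M + M₀ + 1) : ℕ) : ℤ) := torsionH1OfDvd_mem_selmerGroup W hdvd hs₀
  have hne' : ((2 ^ (M₀ - 1) : ℕ) : ℤ) • torsionH1OfDvd W hdvd s₀ ≠ 0 := fun h ↦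
    hne (hinj (by rw [map_zsmul, map_zero, h]))
  obtain ⟨ℓ, d, hkol, hidx, hF, -, -, -, hwit⟩ :=
    Summit.BirchSwinnertonDyer.BirchSwinnertonDyer.Theorems.GenusExact.PlusDescent.exists_primitive_of_two_pow_pred_smul_ne_zero_of_nonPhantom_of_pairSupply
      (fun ℓ ↦ FrobEqFrobInfty W K 2 ℓ) hQ2 W hcm hT K hIQ hodd h3 hHe hρ hNPh Dt β ι d₁ M₀ hndiv hw1
      (Summit.BirchSwinnertonDyer.BirchSwinnertonDyer.Theorems.GenusExact.PlusDescent.pairSupply_frobEqFrobInfty_of_Δ_neg W hcm hneg K hIQ hsq1 hρ)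
      (M + M₀ + 1) (by omega) _ hs₀' hne'
  have hℓp : ℓ.Prime := hkol.1
  refine ⟨1 * ℓ, d, by rw [one_mul]; exact hℓp.squarefree, fun q hq ↦ ?_, hwit⟩
  rw [one_mul, hℓp.primeFactors, Finset.mem_singleton] at hq
  subst hq
  exact ⟨hkol, le_trans (by omega) hidx, hF⟩

open Summit.BirchSwinnertonDyer.BirchSwinnertonDyer.Theses.ByReductionTypeAtTwo
  (GoodOrdinaryRankZeroAtTwo MultiplicativeRankZeroAtTwo SupersingularRankZeroAtTwo AdditiveRankZeroAtTwo) in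
/-- **K₄⁻ AT AN OFF-CUT FRAME ⟸ WALL row 1 + U₂ + Q2 + PRINT + (NPh_K) — sorry-free given (NPh_K) as a hypothesis (v1.2).**  `BSD₂(E)` (WALL rows) and
`BSD₂(Wd)` (U₂) give `#Ш(E/K)[2^∞] = 4^(M₀)` (LEAD pair ledger), hence a class of order `2^(M₀)` in `Ш(E/ℚ)` (LEAD, no cut), hence — through
`Sel_(2^k)(E/ℚ) ↠ Ш(E/ℚ)[2^k]` — a sharp Selmer class, and the off-cut shape theorem above concludes.  Nothing is closed: the hypotheses are OPEN /
print route items and (NPh_K).  [cite: GrossZagier1986, V.§2 (2.2)] [cite: McCallumLMS1991, §5 Thm. 5.4] [cite: LawsonWuthrich2016, §7.1] -/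
theorem offCut_of_wall_U2_of_nonPhantom (hOrd : GoodOrdinaryRankZeroAtTwo) (hMult : MultiplicativeRankZeroAtTwo)
    (hSS : SupersingularRankZeroAtTwo) (hAdd : AdditiveRankZeroAtTwo) (hTw : MinimalTwinBSDTwo) (hQ2 : KolyvaginRelationAtTwo)
    (hGZ : GrossZagierAllLevels) (hGZK : MultPublishedInputsAtTwo) (hL : EntireLFunctionRat) (hMi : MilneAnyModel)
    (W : WeierstrassCurve ℚ) [W.IsElliptic] [W.IsGloballyMinimal] [NeZero (W.conductorNorm ℤ)]
    (hcm : ¬ W.HasCM) (hr0 : W.analyticRank = 0) (hρ : ∀ n : ℕ, 0 < n → W.HasSurjectiveModNGaloisRep ((2 : ℤ) ^ n))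
    (hT : Odd W.tamagawaProduct) (hneg : W.Δ < 0) (h4 : Nat.card (W.selmerGroup 2) = 4)
    (hoff : ¬ ∃ v : HeightOneSpectrum (𝓞 ℚ), ((2 : ℕ) : 𝓞 ℚ) ∉ v.asIdeal ∧ ((W.conductorNorm ℤ : ℕ) : 𝓞 ℚ) ∈ v.asIdeal ∧
      W.HasMultiplicativeReductionAt v)
    (K : Type) [Field K] [NumberField K] (hIQ : IsImaginaryQuadratic K) (hodd : Odd (NumberField.discr K))
    (h3 : NumberField.discr K ≠ -3) (hHe : SatisfiesHeegnerHypothesis (W.conductorNorm ℤ) K)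
    (hsq1 : ¬ IsSquare ((NumberField.discr K : ℚ) * -|W.Δ|)) (hsq2 : ¬ IsSquare ((NumberField.discr K : ℚ) * (-(2 * |W.Δ|))))
    (ℓ : ℕ) (hℓ : ℓ.Prime) (hdK : NumberField.discr K = -(ℓ : ℤ))
    (h2K : ((Ideal.span {(2 : ℤ)}).primesOver (𝓞 K)).ncard = 2)
    (Dt : ModularParametrizationData W (W.conductorNorm ℤ))
    (hopt : ∀ z ∈ Dt.L.lattice, ∃ w ∈ periodLattice Dt.f, z = (Dt.c : ℂ) * w) (hc : Odd Dt.c)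
    (β : ℤ) (ι : K →+* ℂ) (d₁ : KolyvaginHeegnerData Dt β ι 1) (hy : ¬ IsOfFinAddOrder d₁.derivedPoint)
    (M₀ : ℕ) (hdiv : ∃ Q : (W.baseChange (ringClassField K ι 1)).toAffine.Point, ((2 ^ M₀ : ℕ) : ℤ) • Q = d₁.derivedPoint)
    (hndiv : ¬ ∃ Q : (W.baseChange (ringClassField K ι 1)).toAffine.Point, ((2 ^ (M₀ + 1) : ℕ) : ℤ) • Q = d₁.derivedPoint)
    (hM₀ : 1 ≤ M₀)
    (Wd : WeierstrassCurve ℚ) [Wd.IsElliptic] [Wd.IsGloballyMinimal]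
    (hWd : ∃ C : VariableChange ℚ, C • W.quadraticTwist (NumberField.discr K : ℚ) = Wd)
    (hrd : Wd.analyticRank = 1) (hSel : Nat.card (Wd.selmerGroup 2) = 2) (hDEF : padicValNat 2 Wd.tamagawaProduct ≤ 1)
    (hNPh : ∀ (L : ℕ), 1 ≤ L → ∀ z : galH1Torsion (W.baseChange K) ((2 ^ L : ℕ) : ℤ),
      (∀ ρ' ∈ torsionFixing (W.baseChange K) ((2 ^ L : ℕ) : ℤ), h1Eval (W.baseChange K) ((2 ^ L : ℕ) : ℤ) z ρ' = 0) →
      (∀ w : HeightOneSpectrum (𝓞 K), z ∈ selmerLocalKer (W.baseChange K) (w.adicCompletion K) ((2 ^ L : ℕ) : ℤ)) → z = 0) :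
    ∃ (n : ℕ) (d : KolyvaginHeegnerData Dt β ι n), Squarefree n ∧
      (∀ ℓ ∈ n.primeFactors, Zhang2014.IsKolyvaginPrime (W.conductorNorm ℤ) W K 2 ℓ ∧ 2 ≤ Zhang2014.kolyvaginIndex W 2 ℓ ∧
        FrobEqFrobInfty W K 2 ℓ) ∧
      ¬ ∃ Q : (W.baseChange (ringClassField K ι n)).toAffine.Point, (2 : ℤ) • Q = d.derivedPoint := by
  haveI : Fact (Nat.Prime 2) := ⟨Nat.prime_two⟩
  have hs2 : W.HasSurjectiveModNGaloisRep 2 := by simpa using hρ 1 one_pos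
  have hw : W.rootNumber = 1 :=
    (Literature.Barriers.BirchSwinnertonDyer.even_analyticRank_iff_of_isNewformOf_conductorLevel Dt.isNewformOf).mp
      (by rw [hr0]; exact Even.zero)
  have hrk0 : W.mordellWeilRank = 0 := by rw [(hGZK W (by rw [hr0]; exact zero_le_one)).1, hr0]
  have hBW : BSDp W 2 := bsdp_of_wallRows hOrd hMult hSS hAdd W hcm hr0
  have hBd : BSDp Wd 2 := hTw Wd (not_hasCM_twin W hcm K Wd hWd) hrd hSel
  have hpow :=
    Summit.BirchSwinnertonDyer.BirchSwinnertonDyer.Theorems.GenusSupplyNarrow.Lossless.natCard_primaryComponent_sha_baseChange_two_eq_pow_of_bsdp_pair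
      hGZ hL hGZK hMi W hs2 hT hr0 K hIQ hodd h3 hHe Dt hc β ι d₁ M₀ hdiv hndiv Wd hWd hrd hBW hBd
  obtain ⟨k, a, ha, hka, hne⟩ :=
    Summit.BirchSwinnertonDyer.BirchSwinnertonDyer.Theorems.GenusExact.PlusDescent.exists_mem_sha_two_pow_pred_smul_ne_zero_of_natCard_eq_pow
      W K hT hIQ hodd hHe hs2 Dt β ι d₁ hy M₀ hM₀ hndiv hw hrk0 Wd hWd hSel (Or.inl ⟨hneg, hDEF⟩) hpow
  -- `Sel_(2^k)(E/ℚ) ↠ Ш(E/ℚ)[2^k]` (the LEAD's step, verbatim)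
  rcases Nat.eq_zero_or_pos k with rfl | hkpos
  · rw [pow_zero, Nat.cast_one, one_zsmul] at hka
    exact (hne (by rw [hka, zsmul_zero])).elim
  · have hn : ((2 ^ k : ℕ) : ℤ) ≠ 0 := by positivity
    have hmem : a ∈ W.sha ⊓ AddSubgroup.torsionBy W.galH1 ((2 ^ k : ℕ) : ℤ) :=
      AddSubgroup.mem_inf.mpr ⟨ha, by change ((2 ^ k : ℕ) : ℤ) • a = 0; exact hka⟩
    rw [← WeierstrassCurve.map_torsionH1ToH1_selmerGroup_holds W hn] at hmem
    obtain ⟨x, hx, rfl⟩ := AddSubgroup.mem_map.mp hmem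
    have hne' : ((2 ^ (M₀ - 1) : ℕ) : ℤ) • x ≠ 0 := fun h ↦ hne (by rw [← map_zsmul, h, map_zero])
    exact kFour_shape_offCut_of_nonPhantom hQ2 W hcm hneg hT K hIQ hodd h3 hHe hsq1 hρ hNPh Dt β ι d₁ M₀ hndiv hw ⟨k, x, hx, hne'⟩

/-! ## §6 (v1.5–v1.6) THE SPLIT AT `2` AND (v1.6) THE HALVING BIT.  Off the cut, (NPh_K) is one 2-adic bit of `E` (gk2-p4 g32, kernel iff); the bit holds at a `2`-MULTIPLICATIVE place
(gk2-p5 g41 `…k4Neg_offCutNonPhantomAtTwo_of_hasMultiplicativeReductionAt_two`, binders VERBATIM — plugged by name in the composition) and FAILS on every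
other tested `Δ < 0` off-cut cell (LW2 j339762: 32/32; T_A/T_B/T_C).  v1.5 therefore routes the `2`-multiplicative slice through §5 with NO stub, DROPS v1.4's
F4ˢˢ/F4″ⁿˢˢ (F4″ⁿˢˢ is false on the additive cells 47628e1, 90828u1, 155952b1, …: `ξ` Kummer at `2`), and files ONE honest residual F4ᵖᵍ (not multiplicative
at `2`).  T_C stays typed (supersingular, with proof sketch); T_C⁺ types the data-only extension to the potentially-good case.  Nothing is closed; `K4Neg` is
NOT proved; no summit is proved by a line. -/

/-- **F4ᶠ — THE UNHALVABLE (PHANTOM-TWIN) OFF-CUT RESIDUAL (v1.6 stub, rank 3 of the line; the WHOLE remaining content of the kernel K₄⁻ modulo the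
route's own items).**  K₄⁻ VERBATIM on the off-cut cell curves NOT multiplicative at `2`, AT A FRAME WHERE THE HALVING BIT FAILS: some `R ∈ E(K)` has a
`Γ_(K(E[4]))`-fixed half but no half in `E(K)` (`hnh`).  By Lawson–Wuthrich over `K` and the twin dictionary (LEAD-BRIEF-g28 §3; gk2-p4 g34
`TraceBit.forall_torsionFixing_four_smul_eq_iff_selmer_dying_and_four_dvd`) this is the sub-cell «`ξ_E ∈ Sel₂(E)` (automatic on F4ᵖᵍ's habitat: LW2 32/32,
T_C) ∧ `loc_(ℓ₀) ξ_E = 0` ⟺ `4 ∣ a_(ℓ₀)(E)`» — half of the admissible prime frames of every F4ᵖᵍ curve (Čebotarev).  WHY NO MECHANISM: the twin's generator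
`z_d` has Kummer class `ξ_E`, invisible to every regular Kolyvagin prime (`Frob_λ = τ² = 1` on `K(E[4])`), so the pair-separation step of the master halving
descent (`…PairSeparation`, hSep) fails for the Heegner top bit and the single-prime descent is ONE BIT SHORT (pen g28 NOTES `## Barrier notes`); the LEAD
(g28 §3(a)) records «NO engine; possibly K4Neg is FALSE there — disprover-wanted».  v1.5's F4ᵖᵍ = F4ᶠ ∪ (F4ᵖᵍ ∧ hHalf), and the second part is CLOSED by ★★ in
the composition.  Instrument row inside F4ᶠ: 47628e1 (IV* at 2, `#Ш_an = 4`), `K = ℚ(√−47)`, `a_47(E) = −12` (PN-split j341556: tag 𝒫, LOCXI0 = True).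
Why it might fail: as K₄⁻ itself on this sub-cell (Kolyvagin's conjecture at `2` with `ord₂` sharp at depth `M₀` while the Heegner class is a level-4
phantom at every regular prime).  Size L–XL or FALSE. [cite: Kolyvagin1989Izv, Thm. B₂] [cite: LawsonWuthrich2016, §3, §7.1] [cite: MazurRubin2010, Lemma 2.11, Prop. 3.3]
[cite: GrossLMS1991, §9] -/
theorem stub_offCut_notMultAtTwo_unhalvable
    (W : WeierstrassCurve ℚ) [W.IsElliptic] [W.IsGloballyMinimal] [NeZero (W.conductorNorm ℤ)]
    (hcm : ¬ W.HasCM) (hr0 : W.analyticRank = 0) (hρ : ∀ n : ℕ, 0 < n → W.HasSurjectiveModNGaloisRep ((2 : ℤ) ^ n))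
    (hT : Odd W.tamagawaProduct) (hneg : W.Δ < 0) (h4 : Nat.card (W.selmerGroup 2) = 4)
    (hoff : ¬ ∃ v : HeightOneSpectrum (𝓞 ℚ), ((2 : ℕ) : 𝓞 ℚ) ∉ v.asIdeal ∧ ((W.conductorNorm ℤ : ℕ) : 𝓞 ℚ) ∈ v.asIdeal ∧
      W.HasMultiplicativeReductionAt v)
    (hnm2 : ¬ ∃ v₂ : HeightOneSpectrum (𝓞 ℚ), ((2 : ℕ) : 𝓞 ℚ) ∈ v₂.asIdeal ∧ W.HasMultiplicativeReductionAt v₂)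
    (K : Type) [Field K] [NumberField K] (hIQ : IsImaginaryQuadratic K) (hodd : Odd (NumberField.discr K))
    (h3 : NumberField.discr K ≠ -3) (hHe : SatisfiesHeegnerHypothesis (W.conductorNorm ℤ) K)
    (hsq1 : ¬ IsSquare ((NumberField.discr K : ℚ) * -|W.Δ|)) (hsq2 : ¬ IsSquare ((NumberField.discr K : ℚ) * (-(2 * |W.Δ|))))
    (ℓ : ℕ) (hℓ : ℓ.Prime) (hdK : NumberField.discr K = -(ℓ : ℤ))
    (h2K : ((Ideal.span {(2 : ℤ)}).primesOver (𝓞 K)).ncard = 2)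
    (Dt : ModularParametrizationData W (W.conductorNorm ℤ))
    (hopt : ∀ z ∈ Dt.L.lattice, ∃ w ∈ periodLattice Dt.f, z = (Dt.c : ℂ) * w) (hc : Odd Dt.c)
    (β : ℤ) (ι : K →+* ℂ) (d₁ : KolyvaginHeegnerData Dt β ι 1) (hy : ¬ IsOfFinAddOrder d₁.derivedPoint)
    (M₀ : ℕ) (hdiv : ∃ Q : (W.baseChange (ringClassField K ι 1)).toAffine.Point, ((2 ^ M₀ : ℕ) : ℤ) • Q = d₁.derivedPoint)
    (hndiv : ¬ ∃ Q : (W.baseChange (ringClassField K ι 1)).toAffine.Point, ((2 ^ (M₀ + 1) : ℕ) : ℤ) • Q = d₁.derivedPoint)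
    (hM₀ : 1 ≤ M₀)
    (Wd : WeierstrassCurve ℚ) [Wd.IsElliptic] [Wd.IsGloballyMinimal]
    (hWd : ∃ C : VariableChange ℚ, C • W.quadraticTwist (NumberField.discr K : ℚ) = Wd)
    (hrd : Wd.analyticRank = 1) (hSel : Nat.card (Wd.selmerGroup 2) = 2) (hDEF : padicValNat 2 Wd.tamagawaProduct ≤ 1)
    (hnh : ¬ ∀ (R : (W.baseChange K).toAffine.Point) (Q : geomPoints (W.baseChange K)),
      (∀ ρ ∈ torsionFixing (W.baseChange K) (4 : ℤ), ρ • Q = Q) → (2 : ℤ) • Q = toGeomPoints (W.baseChange K) R →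
      ∃ R' : (W.baseChange K).toAffine.Point, (2 : ℤ) • R' = R) :
    ∃ (n : ℕ) (d : KolyvaginHeegnerData Dt β ι n), Squarefree n ∧
      (∀ ℓ ∈ n.primeFactors, Zhang2014.IsKolyvaginPrime (W.conductorNorm ℤ) W K 2 ℓ ∧ 2 ≤ Zhang2014.kolyvaginIndex W 2 ℓ ∧
        FrobEqFrobInfty W K 2 ℓ) ∧
      ¬ ∃ Q : (W.baseChange (ringClassField K ι n)).toAffine.Point, (2 : ℤ) • Q = d.derivedPoint := by
  sorry

/-- **T_C (v1.4, TYPED PROPOSAL — not a stub of the composition; a beyond-print lemma at `p = 2` for a refuter/prover to land under Theorems/):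
THE PHANTOM SELMER CLASS.**  For `E/ℚ` non-CM with `Δ < 0`, good supersingular reduction at `2`, odd `C(E)`, no odd multiplicative prime and `ρ_(E,4)`
onto, the inflation `φ′` of the generator of `H¹(Gal(ℚ(E[4])/ℚ), E[2]) ≅ 𝔽₂` (`= Hom_(S₃)(1+2M₂(𝔽₂) ↠ V, E[2])`) is a NON-ZERO element of `Sel₂(E/ℚ)`
that dies on `Gal(ℚ̄/ℚ(E[4]))`: at `2` it is `0` (`a₂ = 0`) or the Kummer class of the generator of `E(ℚ₂)/2` (`a₂ = ±2`, kit j341300); at odd additive `p`,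
`H¹(ℚ_p, E[2]) = 0` (`c_p` odd); at good `p` it is unramified; at `∞`, `H¹(ℝ, E[2]) = 0` for `Δ < 0`.  COROLLARY: `rank E(ℚ) = 0 ⟹ Ш(E/ℚ)[2] ≠ 0` on this
habitat (no K₁⁻ cell is supersingular-off-cut; Cremona: the four rank-`0` members all have `#Sel₂ = 4`), and `i_* φ′ = φ₂` is the Selmer phantom that kills
(NPh_K).  Falsifier: a rank-`0` curve on the habitat with `#Sel₂(E/ℚ) = 1` (kit phantom9/10 sweep over integral `j`). [cite: LawsonWuthrich2016, §7.1, §8] -/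
def PhantomSelmerClassAtTwo_T : Prop :=
  ∀ (W : WeierstrassCurve ℚ) [W.IsElliptic] [W.IsGloballyMinimal] [NeZero (W.conductorNorm ℤ)],
    ¬ W.HasCM → W.Δ < 0 → Literature.NumberTheory.EllipticCurves.Rank1Residual.GoodSS W 2 → Odd W.tamagawaProduct →
    (¬ ∃ v : HeightOneSpectrum (𝓞 ℚ), ((2 : ℕ) : 𝓞 ℚ) ∉ v.asIdeal ∧ ((W.conductorNorm ℤ : ℕ) : 𝓞 ℚ) ∈ v.asIdeal ∧
      W.HasMultiplicativeReductionAt v) →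
    W.HasSurjectiveModNGaloisRep ((2 : ℤ) ^ 2) →
    ∃ z : galH1Torsion W ((2 : ℕ) : ℤ), z ≠ 0 ∧
      (∀ ρ' ∈ torsionFixing W ((4 : ℕ) : ℤ), h1Eval W ((2 : ℕ) : ℤ) z ρ' = 0) ∧
      (∀ v : HeightOneSpectrum (𝓞 ℚ), z ∈ selmerLocalKer W (v.adicCompletion ℚ) ((2 : ℕ) : ℤ))

/-- **T_C⁺ (v1.5, TYPED, DATA-ONLY extension of T_C to the potentially-good case — a refutable conjecture, not a stub of the composition).**  For `E/ℚ` with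
`Δ < 0`, odd `C(E)`, no odd multiplicative prime, NOT multiplicative at `2`, and `ρ_(E,4)` onto: the Lawson–Wuthrich class is an everywhere-Selmer non-zero
class of `H¹(ℚ, E[2])` dying on `Gal(ℚ̄/ℚ(E[4]))`.  Evidence: LW2 (kit j339762) 32/32 cells `N < 5·10⁵` (16 supersingular, 16 additive of types II*, IV, IV*);
no structural argument at an additive `2` yet (the supersingular case is T_C).  Falsifier: one such curve with `α = −Δ·F′(e)` NOT locally a square class in the
Kummer image at a prime of `ℚ(e)` over `2` (instrument LW2 / phantom8b), or a rank-`0` member with `#Sel₂ = 1`. [cite: LawsonWuthrich2016, §7.1, §8] -/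
def PhantomSelmerClassPotGood_T : Prop :=
  ∀ (W : WeierstrassCurve ℚ) [W.IsElliptic] [W.IsGloballyMinimal] [NeZero (W.conductorNorm ℤ)],
    ¬ W.HasCM → W.Δ < 0 → Odd W.tamagawaProduct →
    (¬ ∃ v : HeightOneSpectrum (𝓞 ℚ), ((2 : ℕ) : 𝓞 ℚ) ∉ v.asIdeal ∧ ((W.conductorNorm ℤ : ℕ) : 𝓞 ℚ) ∈ v.asIdeal ∧
      W.HasMultiplicativeReductionAt v) →
    (¬ ∃ v₂ : HeightOneSpectrum (𝓞 ℚ), ((2 : ℕ) : 𝓞 ℚ) ∈ v₂.asIdeal ∧ W.HasMultiplicativeReductionAt v₂) →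
    W.HasSurjectiveModNGaloisRep ((2 : ℤ) ^ 2) →
    ∃ z : galH1Torsion W ((2 : ℕ) : ℤ), z ≠ 0 ∧
      (∀ ρ' ∈ torsionFixing W ((4 : ℕ) : ℤ), h1Eval W ((2 : ℕ) : ℤ) z ρ' = 0) ∧
      (∀ v : HeightOneSpectrum (𝓞 ℚ), z ∈ selmerLocalKer W (v.adicCompletion ℚ) ((2 : ℕ) : ℤ))

open Summit.BirchSwinnertonDyer.BirchSwinnertonDyer.Theses.ByReductionTypeAtTwo
  (GoodOrdinaryRankZeroAtTwo MultiplicativeRankZeroAtTwo SupersingularRankZeroAtTwo AdditiveRankZeroAtTwo) in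
/-- **COMPOSITION v1.6 — `K4Neg` ⟸ WALL row 1 + U₂ + Q2 + PRINT + F4ᶠ (the ONE residual stub on the path).**  FIRST the halving bit: if hHalf holds at
the frame, the LEAD's ★★ `PlusDescent.kFourNeg_conclusion_of_bsdp_pair_of_halvingBit` (0 sorry; ANY `Δ < 0` frame) fed by `BSD₂(E)` (`bsdp_of_wallRows`, WALL
row 1 by name) and `BSD₂(Wd)` (U₂ `MinimalTwinBSDTwo` by name; the twin is non-CM, `r_an = 1`, `#Sel₂ = 2`).  ELSE the v1.5 roads: on the cut §4
(`onCut_of_wall_U2`, no stub); off the cut and MULTIPLICATIVE AT `2`: `offCut_of_wall_U2_of_nonPhantom` fed by gk2-p5 g41's theorem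
`…Lw2PhantomExclusion.k4Neg_offCutNonPhantomAtTwo_of_hasMultiplicativeReductionAt_two` (no stub); off the cut, NOT multiplicative at `2` and UNHALVABLE: the
residual F4ᶠ.  `K4Neg` is NOT proved (F4ᶠ open, engine-less, possibly false; WALL row 1, U₂, Q2 are OPEN route items); BSD is not proved; no summit is
proved by a line. -/
theorem K4Neg_of_wall_U2_split (hOrd : GoodOrdinaryRankZeroAtTwo) (hMult : MultiplicativeRankZeroAtTwo)
    (hSS : SupersingularRankZeroAtTwo) (hAdd : AdditiveRankZeroAtTwo) (hTw : MinimalTwinBSDTwo) (hQ2 : KolyvaginRelationAtTwo)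
    (hGZ : GrossZagierAllLevels) (hGZK : MultPublishedInputsAtTwo) (hL : EntireLFunctionRat) (hMi : MilneAnyModel) :
    Summit.BirchSwinnertonDyer.BirchSwinnertonDyer.Theses.GenusKolyvaginAtTwo.K4Neg := by
  intro W _ _ _ hcm hr0 hρ hT hneg h4 K _ _ hIQ hodd h3 hHe hsq1 hsq2 ℓ₀ hℓ₀ hdK h2K Dt hopt hc β ι d₁ hy M₀ hdiv hndiv hM₀ Wd _ _ hWd
    hrd hSel hDEF
  by_cases hH : ∀ (R : (W.baseChange K).toAffine.Point) (Q : geomPoints (W.baseChange K)),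
      (∀ ρ ∈ torsionFixing (W.baseChange K) (4 : ℤ), ρ • Q = Q) → (2 : ℤ) • Q = toGeomPoints (W.baseChange K) R →
      ∃ R' : (W.baseChange K).toAffine.Point, (2 : ℤ) • R' = R
  · exact Summit.BirchSwinnertonDyer.BirchSwinnertonDyer.Theorems.GenusExact.PlusDescent.kFourNeg_conclusion_of_bsdp_pair_of_halvingBit hQ2 hGZ hGZK
      hL hMi W hcm hr0 hρ hT hneg K hIQ hodd h3 hHe hsq1 hsq2 Dt hc β ι d₁ hy M₀ hdiv hndiv hM₀ Wd hWd hrd hSel hDEF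
      (bsdp_of_wallRows hOrd hMult hSS hAdd W hcm hr0) (hTw Wd (not_hasCM_twin W hcm K Wd hWd) hrd hSel) hH
  by_cases hcut : ∃ v : HeightOneSpectrum (𝓞 ℚ), ((2 : ℕ) : 𝓞 ℚ) ∉ v.asIdeal ∧ ((W.conductorNorm ℤ : ℕ) : 𝓞 ℚ) ∈ v.asIdeal ∧
      W.HasMultiplicativeReductionAt v
  · obtain ⟨v, h2v, hNv, hmult⟩ := hcut
    exact onCut_of_wall_U2 hOrd hMult hSS hAdd hTw hQ2 hGZ hGZK hL hMi W hcm hr0 hρ hT hneg h4 v h2v hNv hmult K hIQ hodd h3 hHe hsq1 hsq2 ℓ₀ hℓ₀ hdK h2K Dt hopt hc β ι d₁ hy M₀ hdiv hndiv hM₀ Wd hWd hrd hSel hDEF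
  · by_cases hm2 : ∃ v₂ : HeightOneSpectrum (𝓞 ℚ), ((2 : ℕ) : 𝓞 ℚ) ∈ v₂.asIdeal ∧ W.HasMultiplicativeReductionAt v₂
    · obtain ⟨v₂, h2v, hmult⟩ := hm2
      exact offCut_of_wall_U2_of_nonPhantom hOrd hMult hSS hAdd hTw hQ2 hGZ hGZK hL hMi W hcm hr0 hρ hT hneg h4 hcut K hIQ hodd h3 hHe hsq1 hsq2 ℓ₀ hℓ₀ hdK h2K Dt hopt hc β ι d₁ hy M₀ hdiv hndiv hM₀ Wd hWd hrd hSel hDEF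
        (fun L hL z hz hw ↦ Summit.BirchSwinnertonDyer.BirchSwinnertonDyer.Theorems.GenusExact.Lw2PhantomExclusion.k4Neg_offCutNonPhantomAtTwo_of_hasMultiplicativeReductionAt_two
          W hcm hr0 hρ hT hneg h4 hcut K hIQ hodd h3 hHe hsq1 hsq2 h2K h2v hmult L hL z hz (fun w _ ↦ hw w))
    · exact stub_offCut_notMultAtTwo_unhalvable W hcm hr0 hρ hT hneg h4 hcut hm2 K hIQ hodd h3 hHe hsq1 hsq2 ℓ₀ hℓ₀ hdK h2K Dt hopt hc β ι d₁ hy M₀ hdiv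
        hndiv hM₀ Wd hWd hrd hSel hDEF hH

end Summit.BirchSwinnertonDyer.BirchSwinnertonDyer.Cruxes.K4Neg.TwinBsdRoad

end
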